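import Summits.QuantumFields.YangMills.Theorems.BalabanUVNodesN24K1ByNameOfOpenStubsChildrenSplit
import Summits.QuantumFields.YangMills.Theorems.BalabanUVNodesK1WindowExactCriterion
import Summits.QuantumFields.YangMills.Theorems.BalabanUVNodesK1BetaWindow13SOfNodes13PWSOfBoxH

/-!
# NODE N24 (B2) — K1⁷ AT THE WITNESS WITH NODE O READ EXACTLY AS THE DAG READS IT: [III] (2.6) ALONG THE DATUM's OWN RUNS, i.e. a RUN-WISE CEILING (first member; PAID HERE by K0's box at the
# door, `B := β′`) and the RUN-WISE NO-HALVING of the effective coupling (last member at the road's `β₀ := 1`) — ym-nodeO-ideate P3 g52's n°89 «DAG-exact K1 bill» (ASK S-26) ported to the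
# tree as theorems (letters UNFOLDED, no definition) and wired into the split closers: the door variant `…_of_ceiling_noHalving_door` and ★ the NO-HALVING-ONLY closing forms (general `N`,
# `N = 2` from the two open V19 stub texts, and the route decl BY NAME) — the logically weakest NODE-O letter the typed DAG can read (weaker than 32H's partial-sum floor, P3 n°89 :151)

TRACK A (YM-PLAN §2d, node N24 of 28 = binder B2), seat `pub-ymgap-dag-n24-c` (R134 fan-out seat, strategy s2; gen 9, Part 30).  Key of record: K1⁷ `StabilityBAtRecordR13SepCoPH` =
stmt-QuantumFields-20542; this file `--supports` it as a helper (Summits lane; inside the theses cone through Part 29's imports, advisory).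
WHY (ym-nodeO-ideate P3 g52 EVIDENCE-N89 ∕ ASK S-26, memo `ym-nodeO-ideate/memos/lines/OneKeyAfter32H-P3g52.lean` §1–§2, kernel-checked there; ported here WITH ATTRIBUTION, letters unfolded
since the memo's `RunwiseCeiling ∕ RunwiseMulFloor` are not tree definitions).  At a rung-1 world the (B)-engine `DagBinding.endStatementBPrinted_of_worldsP ∘ uvStability_of_nodes` reads NODE O
ONLY through the leaf `Dag.FlowStepPrinted (leavesP w P) := smallCouplings → flowControl`, and `flowControl = B14.FlowIneq26 (w.C P).flow.g w.βup w.β₀ P.K` = (2.6) p.255: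
`g_n ≤ √(1 + g_n²·βup·(n−m))·g_m ∧ g_m ≤ (1+β₀)·g_n` (`m < n ≤ K`) along the datum's own in-window runs; the first member follows from a RUN-WISE CEILING `β_k(g_0..g_k) ≤ βup` (n24-w1's
`flow26_upper_of_rg_upper`, NO sign), the last member IS the run-wise no-`(1+β₀)⁻¹`-shrink letter; the window clause follows from the ceiling (dag-n13-w4's `window_of_frequently_beta_le`).
§0 ports the memo's four lemmas (`flowIneq26_alongRun_of_ceiling_noShrink`, `flowStepPrinted_leavesP_of_ceiling_noShrink`, `frequently_betaZero_le_of_runwiseCeiling`,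
`stabilityB_body_of_rung1At_of_ceiling_noShrink`) + `runwiseCeiling_of_betaUpperH` (the ceiling from a box, as 32H §0).  §1 (general `N`, door letters fixed): the door variant S-26 asks for —
the ten split children (Part 23's TYPES) + ceiling `B` + no-shrink at `β₀ := 1` on a level `γ₀ > 0`, world built with `(βup, β₀) := (B, 1)` — and ★ `…_noHalving_door`: the CEILING DISCHARGED
from the door's `hbox'` (`B := β′`, level `min γ γ₀`), so NODE O's letter is NO-HALVING ALONE `∀ n gs, RGEqH n β₁₃(θ) gs → Step.InInterval γ₀ n gs → ∀ m < n′ ≤ n, g_m ≤ 2·g_{n′}`.  §2 `N = 2`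
from the two OPEN V19 stub texts (stub 2′ by name, k0-s2-w1) + children families + the no-halving family `hnhF`; §3 the route decl BY NAME (Part 29's pattern, `K1V6Defs.stabilityBAtRecordR13SepCoPH_iff`).
LADDER of NODE-O letters for K1⁷ at the witness now in the tree (each implies the next): positive box floor `hOF` (29H) ⟹ sign `hsignF` (33H) ⟹ partial-sum floor `hpsF` (32H) ⟹ no-halving `hnhF`
(THIS FILE; the converse fails — P3 n°89's counting model :112; the implication PS floor ⟹ no-halving on a shrunk window is the memo's :151∕:186, not re-ported here).
A NEW importing module (imports Part 29 + n24-w1's `K1WindowExactCriterion` + n13-w4∕n24-w1's `K1BetaWindow13SOfNodes13PWSOfBoxH`).  THEOREMS ONLY, def-free, sorry-free, standard axioms.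

HONEST FRAMING: composition BY NAME + P3's elementary flow bookkeeping (credited); (2.6)'s last member for the full model is UNPRINTED as a theorem exactly like the sign and [I] Thm 2 — it is a
DISPLAYED hypothesis; nothing of Bałaban's asserted; K0⁷ ∕ K1⁷ NOT closed; no stub closed; N24 COMPOSITE — no discharge, no count moved (5∕27 · A 5∕28); one finite 𝕋⁴ programme at fixed ε; R4 =
the conditional finite-𝕋⁴ rung `BalabanLadder.UV` only — NOT continuum ∕ ℝ⁴ ∕ OS ∕ mass gap ∕ Clay.
-/

noncomputable section

open scoped Matrix.Norms.L2Operator BigOperators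
open Filter Topology

namespace Summit.QuantumFields.YangMills.BalabanUVNodes.N24K1OfChildrenSplitFlow26LettersWorldBuilt

open Literature.MathematicalPhysics.QuantumFieldTheory.Balaban1983to89
open Literature.MathematicalPhysics.QuantumFieldTheory.Balaban1983to89.Node00
open DagBinding T4Continuum T4DatumAssembly FlowStepRuns AveragingRT
open FlowStep (HBeta RGEqH prefixOf prefixOf_apply BetaLowerH BetaUpperH Box mem_box)
open Summit.QuantumFields.YangMills.BalabanUVNodes.N07Thm1Top7FromProp8 (variationalThm1RegSepCoP7M_of_prop8TopStep)
open Summit.QuantumFields.YangMills.Theorems.K0PrintCubeOfStepTokensR (gauge9Supplier_of_prop6MemberP)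
open Summit.QuantumFields.YangMills.BalabanUVNodes.N24K1ConsequentOfStubsV19AndChildren (windowLetters_of_absBetaBoxH)
open Summit.QuantumFields.YangMills.BalabanUVNodes.K1EndOfNodes13PWSOfPartialSums (flow26_upper_of_rg_upper)
open Summit.QuantumFields.YangMills.BalabanUVNodes.K1EndOfNodes13PWSOfRunRemAt (stepInInterval_of_flowInInterval)
open Summit.QuantumFields.YangMills.BalabanUVNodes.K1BetaWindow13SOfNodes13PWSOfBoxH (nodes_leavesP_reletter_of_le_all isRecordOfRecord₁₃CSepCoPHS_reletter_of_le)
open Summit.QuantumFields.YangMills.Theorems.BalabanUVNodesK1WindowExactCriterion (window_of_frequently_beta_le)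
open Summit.QuantumFields.YangMills.Theorems.K0V19Defs (Prop8StepCoPAt AbsBetaBoxAtThm1WitnessCCMGenAt)
open Summit.QuantumFields.YangMills.Theorems.K1V6Defs (stabilityBAtRecordR13SepCoPH_iff)

variable {F : T4Family}

/-! ## §0. (2.6) along runs from a run-wise ceiling and the run-wise no-shrink letter (ym-nodeO-ideate P3 g52 n°89 §1–§2, ported; letters unfolded); the ceiling from a box -/

/-- **BOX ⟹ RUN-WISE CEILING at every level `γ₀ ≤ γ`** (every prefix of a run staying in `]0, γ₀]` lies in `]0, γ]^(k+1)`; as 32H §0). [cite: Balaban1987RG1, (1.22) p.264, Thm 3 p.264 (bookkeeping)] -/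
theorem runwiseCeiling_of_betaUpperH {β : HBeta} {β' γ γ₀ : ℝ} (hhi : BetaUpperH β' γ β) (hγ₀ : γ₀ ≤ γ) :
    ∀ (n : ℕ) (gs : ℕ → ℝ), RGEqH n β gs → Step.InInterval γ₀ n gs → ∀ k, k ≤ n → β k (prefixOf gs k) ≤ β' := by
  intro n gs _ hI k hk
  exact hhi k _ (mem_box.mpr fun i => ⟨(hI i ((Nat.le_of_lt_succ i.isLt).trans hk)).1, (hI i ((Nat.le_of_lt_succ i.isLt).trans hk)).2.trans hγ₀⟩)

/-- **(2.6) ALONG ONE RUN OF ANY CONSTRUCTION CURRYING `β`** from the run-wise ceiling (first member via n24-w1's `flow26_upper_of_rg_upper` — NO sign) and the run-wise no-shrink letter (last member,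
verbatim), both on a level `γ₀ ≥` the run's window `γ` (P3 n°89 `flowIneq26_alongRun_of_ceiling_mulFloor`, ported). [cite: Balaban1988Convergent, (2.6) p.255; Balaban1987RG1, (0.20) p.256] -/
theorem flowIneq26_alongRun_of_ceiling_noShrink (C : B12.Construction) (β : HBeta) (hcur : CurriesHBeta C β) {B β₀ γ₀ γ : ℝ} (hγ : γ ≤ γ₀)
    (hceil : ∀ (n : ℕ) (gs : ℕ → ℝ), RGEqH n β gs → Step.InInterval γ₀ n gs → ∀ k, k ≤ n → β k (prefixOf gs k) ≤ B)
    (hmul : ∀ (n : ℕ) (gs : ℕ → ℝ), RGEqH n β gs → Step.InInterval γ₀ n gs → ∀ m n', m < n' → n' ≤ n → gs m ≤ (1 + β₀) * gs n')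
    (P : B12.RunParams) (hrg : (C P).flow.SatisfiesRG P.K) (hI : (C P).flow.InInterval γ P.K) :
    B14.FlowIneq26 (C P).flow.g B β₀ P.K := by
  have hRG : RGEqH P.K β (C P).flow.g := rgEqH_of_curries C β hcur P hrg
  have hIs : Step.InInterval γ₀ P.K (C P).flow.g := stepInInterval_of_flowInInterval _ hI hγ le_rfl
  have hub : ∀ j, j < P.K → (C P).flow.β (j + 1) ((C P).flow.g j) ≤ B := fun j hj => by
    rw [hcur P j _ hj, update_prefixOf_last]
    exact hceil P.K _ hRG hIs j hj.le
  exact fun m n hmn hnK => ⟨flow26_upper_of_rg_upper (C P).flow P.K (fun j hj => (hI j hj).1) hrg hub m n hmn hnK, hmul P.K _ hRG hIs m n hmn hnK⟩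

variable {N : ℕ} [NeZero N]

/-- **THE DAG LEAF `Dag.FlowStepPrinted` AT AN S-CLASS RUNG-1 WORLD from the two run-wise letters at the world's own `(βup, β₀)`** on a level `γ₀ ≥ w.γ` ((0.20) along the run: dag-n10-d's
`rgFlow_of_smallCouplings_of_isRecordOfRecord₁₃CSepCoPHS`; the datum curries its `βfun`) (P3 n°89 `flowStepPrinted_leavesP_of_ceiling_mulFloor`, ported). [cite: Balaban1988Convergent, (2.6) p.255; Balaban1989LargeFieldII, (0.1) pp.355–356] -/
theorem flowStepPrinted_leavesP_of_ceiling_noShrink {D : FiniteEpsData F (SU N)} {w : WorldP} (hRS : IsRecordOfRecord₁₃CSepCoPHS F N D w)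
    {γ₀ : ℝ} (hγ : w.γ ≤ γ₀)
    (hceil : ∀ (n : ℕ) (gs : ℕ → ℝ), RGEqH n D.βfun gs → Step.InInterval γ₀ n gs → ∀ k, k ≤ n → D.βfun k (prefixOf gs k) ≤ w.βup)
    (hmul : ∀ (n : ℕ) (gs : ℕ → ℝ), RGEqH n D.βfun gs → Step.InInterval γ₀ n gs → ∀ m n', m < n' → n' ≤ n → gs m ≤ (1 + w.β₀) * gs n') (P : B12.RunParams) :
    Dag.FlowStepPrinted (leavesP w P) := by
  intro hsc
  have hC : w.C = D.C := construction_eq_of_isRecordOfRecord₁₃CSepCoPHS hRS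
  have hrgP : (D.C.toB12 P).flow.SatisfiesRG P.K := by
    have h' := rgFlow_of_smallCouplings_of_isRecordOfRecord₁₃CSepCoPHS hRS P hsc
    show (D.C P).flow.SatisfiesRG P.K
    rw [← hC]; exact h'
  have hsc' : (D.C.toB12 P).flow.InInterval w.γ P.K := by
    show (D.C P).flow.InInterval w.γ P.K
    rw [← hC]; exact hsc
  show B14.FlowIneq26 (w.C P).flow.g w.βup w.β₀ P.K
  rw [hC]
  exact flowIneq26_alongRun_of_ceiling_noShrink D.C.toB12 D.βfun D.curries hγ hceil hmul P hrgP hsc'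

/-- **THE CEILING PAYS THE WINDOW INPUT**: a run-wise ceiling read on the one-point run `(x)`, `x ∈ ]0, γ₀[`, bounds `β_0`, hence the frequent level-0 bound of dag-n13-w4's window criterion
(P3 n°89 `frequently_betaZero_le_of_runwiseCeiling`, ported). [cite: Balaban1987RG1, (0.17)–(0.20) pp.255–256, §1 p.264 (elementary)] -/
theorem frequently_betaZero_le_of_runwiseCeiling {β : HBeta} {B γ₀ : ℝ} (hγ₀ : 0 < γ₀)
    (h : ∀ (n : ℕ) (gs : ℕ → ℝ), RGEqH n β gs → Step.InInterval γ₀ n gs → ∀ k, k ≤ n → β k (prefixOf gs k) ≤ B) :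
    ∃ b : ℝ, ∃ᶠ x in 𝓝[>] (0 : ℝ), β 0 (fun _ => x) ≤ b := by
  have hlt : ∀ᶠ x in 𝓝[>] (0 : ℝ), x < γ₀ := (eventually_lt_nhds hγ₀).filter_mono nhdsWithin_le_nhds
  have hpos : ∀ᶠ x in 𝓝[>] (0 : ℝ), 0 < x := eventually_mem_nhdsWithin
  have hev : ∀ᶠ x in 𝓝[>] (0 : ℝ), β 0 (fun _ => x) ≤ B := by
    filter_upwards [hlt, hpos] with x hx hx0
    have hRG : RGEqH 0 β (fun _ => x) := fun k hk => absurd hk (Nat.not_lt_zero k)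
    have hI : Step.InInterval γ₀ 0 (fun _ => x) := fun _ _ => ⟨hx0, hx.le⟩
    have h1 := h 0 (fun _ => x) hRG hI 0 le_rfl
    have e : prefixOf (fun _ : ℕ => x) 0 = fun _ => x := rfl
    rw [e] at h1
    exact h1
  exact ⟨B, hev.frequently⟩

/-- **★ THE K1 BILL PAID BY NODE O's TWO RUN-WISE (2.6)-LETTERS AT THE WORLD's OWN `(βup, β₀)`** on some level `γ₀ > 0` (window re-lettered to `min w.γ γ₀` by n13-w4∕n24-w1's
`isRecordOfRecord₁₃CSepCoPHS_reletter_of_le` ∕ `nodes_leavesP_reletter_of_le_all`; (B) by `endStatementBPrinted_of_worldsP ∘ uvStability_of_nodes`; the window clause read off the ceiling by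
`window_of_frequently_beta_le`) — P3 n°89 `stabilityB_body_of_rung1At_of_ceiling_mulFloor`, ported with the letters unfolded.  CONDITIONAL; closes nothing. [cite: Balaban1988Convergent, (2.6) p.255, Cor. 3 (2.50) p.264, Thm 1 p.262; Balaban1987RG1, (0.17)–(0.20) pp.255–256, Thm 2 p.259, Thm 3 p.264, (1.20)–(1.22) p.264, §1 p.264; Balaban1989LargeFieldII, Thm 1 p.355, (0.1) pp.355–356, p.391; Balaban1985Variational, Thm 1 (8)–(9) p.279, Prop. 8 p.304; Balaban1985RegularSpaces, Prop. 6 p.99 (bookkeeping)] -/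
theorem stabilityB_body_of_rung1At_of_ceiling_noShrink (θ : Stage13HParams F N) (h : θ.Provisos₁₃SepCoPH F N) (w : WorldP)
    (hU : θ.ZhUnity F N ∧ θ.SlotsNondegenerate₁₃ F N) (hθ : θ.Admissible F N)
    (hR : ∃ (θ' : Stage13HParams F N) (h' : θ'.Provisos₁₃SepCoPH F N), θ'.Admissible F N ∧
      datumOfRecord₁₃SepCoPH F N θ h = datumOfRecord₁₃SepCoPH F N θ' h' ∧ w.C = (datumOfRecord₁₃SepCoPH F N θ h).C ∧ (0 < w.γ ∧ w.γ ≤ θ'.γ) ∧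
      w.L = (θ'.L : ℝ) ∧ ∀ P : B12.RunParams, w.up P = upOfRecord₅CS F N (θ'.toStage5₁₃CoPH F N) P)
    (hnodes : ∀ P : B12.RunParams, Nodes (leavesP w P))
    {γ₀ : ℝ} (hγ₀ : 0 < γ₀)
    (hceil : ∀ (n : ℕ) (gs : ℕ → ℝ), RGEqH n (betaOfRecord₁₃ F N θ.toStage13Params) gs → Step.InInterval γ₀ n gs → ∀ k, k ≤ n → betaOfRecord₁₃ F N θ.toStage13Params k (prefixOf gs k) ≤ w.βup)
    (hmul : ∀ (n : ℕ) (gs : ℕ → ℝ), RGEqH n (betaOfRecord₁₃ F N θ.toStage13Params) gs → Step.InInterval γ₀ n gs → ∀ m n', m < n' → n' ≤ n → gs m ≤ (1 + w.β₀) * gs n') :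
    (θ.ZhUnity F N ∧ θ.SlotsNondegenerate₁₃ F N) ∧ θ.Admissible F N ∧ B16.EndStatementBPrinted (datumOfRecord₁₃SepCoPH F N θ h).C ∧
      ∃ γ₁ : ℝ, 0 < γ₁ ∧ ∀ γ : ℝ, 0 < γ → γ ≤ γ₁ → ∃ P : B12.RunParams, 1 ≤ P.K ∧ ((datumOfRecord₁₃SepCoPH F N θ h).C P).flow.InInterval γ P.K := by
  have hRS := (recordS₁₃SepCoPH_iff F N θ h w).1 hR
  have hγw : 0 < w.γ := gamma_pos_of_isRecordOfRecord₁₃CSepCoPHS hRS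
  have hC : w.C = (datumOfRecord₁₃SepCoPH F N θ h).C := construction_eq_of_isRecordOfRecord₁₃CSepCoPHS hRS
  have hγ₁ : 0 < min w.γ γ₀ := lt_min hγw hγ₀
  have hRS' : IsRecordOfRecord₁₃CSepCoPHS F N (datumOfRecord₁₃SepCoPH F N θ h) { w with γ := min w.γ γ₀, b := w.b, b_pos := w.b_pos } :=
    isRecordOfRecord₁₃CSepCoPHS_reletter_of_le hRS hγ₁ (min_le_left _ _) w.b_pos
  have hB : B16.EndStatementBPrinted ({ w with γ := min w.γ γ₀, b := w.b, b_pos := w.b_pos } : WorldP).C :=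
    endStatementBPrinted_of_worldsP { w with γ := min w.γ γ₀, b := w.b, b_pos := w.b_pos } hγ₁ fun P =>
      uvStability_of_nodes _ (nodes_leavesP_reletter_of_le_all w (min_le_left _ _) w.b_pos hnodes P)
        (flowStepPrinted_leavesP_of_ceiling_noShrink hRS' (min_le_right _ _) hceil hmul P)
  refine ⟨hU, hθ, ?_, window_of_frequently_beta_le (datumOfRecord₁₃SepCoPH F N θ h) (frequently_betaZero_le_of_runwiseCeiling hγ₀ hceil)⟩
  have : ({ w with γ := min w.γ γ₀, b := w.b, b_pos := w.b_pos } : WorldP).C = (datumOfRecord₁₃SepCoPH F N θ h).C := hC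
  rw [← this]
  exact hB

/-! ## §1. General `N`, door letters fixed: K1⁷'s consequent from the ten split children + NODE O's (2.6)-letters; then the CEILING DISCHARGED from K0's box — NO-HALVING ALONE -/

/-- **★★ ASK S-26 (ym-nodeO-ideate P3 g52): THE DOOR VARIANT `…_of_ceiling_noHalving_door`** — K1⁷'s consequent at the witness (general `N`) from the ten world-free children (Part 23's TYPES) and
NODE O's two run-wise (2.6)-letters of the witness's β of record on a level `γ₀ > 0`: a CEILING `β_k ≤ B` and NO-HALVING `g_m ≤ 2·g_{n′}` (`m < n′ ≤ n`) along every in-window (0.20)-run; the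
world BUILT here with `(βup, β₀) := (B, 1)` so that both letters are AT THE WORLD's OWN LETTERS by `rfl` (§0 `stabilityB_body_of_rung1At_of_ceiling_noShrink`).  [cite: Balaban1988Convergent, (2.6) p.255, Cor. 3 (2.50) p.264, Thm 1 p.262; Balaban1987RG1, (0.17)–(0.20) pp.255–256, Thm 2 p.259, Thm 3 p.264, (1.20)–(1.22) p.264, §1 p.264; Balaban1989LargeFieldII, Thm 1 p.355, (0.1) pp.355–356, p.391; Balaban1985Variational, Thm 1 (8)–(9) p.279, Prop. 8 p.304; Balaban1985RegularSpaces, Prop. 6 p.99 (bookkeeping)] -/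
theorem N24_stabilityBR13SepCoPH_worldBuilt_childrenSplit_ceiling_noHalving_theta13OfThm1CCMW_of_gauge9TopStepR_of_betaBoxSignFree_allTorus_door {j c : ℕ} {γ ε₀ ε₂₉ B₃ B₃' a₀ a₁ : ℝ} (hγ₀ : 0 < γ) (hγh : γ ≤ 1 / 2)
    (hε : 0 < ε₀) (hε' : 0 < ε₂₉) (hB : 0 ≤ B₃) (hB' : 0 ≤ B₃') (ha₀ : 0 < a₀) (ha₁ : 0 < a₁)
    (h15 : VariationalThm1RegSepCoP7M F N B₃ a₀ a₁) (hc : c ≤ F.L ^ j)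
    (h9 : Gauge9RegSepTopStepR F N (fun ν K Ω => suppDomOfRecord F ν K Ω) (F.L ^ j) c B₃ B₃' a₀ a₁)
    {bl β' : ℝ} (hbox : BetaLowerH bl γ (betaOfRecord₁₃ F N (theta13OfThm1CCMW F N j γ ε₀ ε₂₉ B₃ B₃' a₀ a₁)))
    (hbox' : BetaUpperH β' γ (betaOfRecord₁₃ F N (theta13OfThm1CCMW F N j γ ε₀ ε₂₉ B₃ B₃' a₀ a₁))) (hl : -bl * γ ^ 2 ≤ 3) (hβ' : β' * γ ^ 2 ≤ 3 / 4)
    (h05 : ∃ lam8 : ResidB8 (theta13OfThm1CCMW F N j γ ε₀ ε₂₉ B₃ B₃' a₀ a₁).toStage3Params, B8LeafOfRecordSubBP (theta13OfThm1CCMW F N j γ ε₀ ε₂₉ B₃ B₃' a₀ a₁).toStage3Params lam8)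
    (h06 : ∃ (Mstar : ℕ) (ops : OpsY N (theta13OfThm1CCMW F N j γ ε₀ ε₂₉ B₃ B₃' a₀ a₁).toStage3Params Mstar), B9LeafX (Y9OfRecord N (theta13OfThm1CCMW F N j γ ε₀ ε₂₉ B₃ B₃' a₀ a₁).toStage3Params Mstar ops))
    (h07 : ∃ ζ : ResidZ F N, B11Leaf (Z11OfRecord F N ζ))
    (h08 : PrintedUV3V N F.L)
    (h09 : ∃ lam12 : ResidB12 F N (theta13OfThm1CCMW F N j γ ε₀ ε₂₉ B₃ B₃' a₀ a₁).τ9.M,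
      ∀ P : B12.RunParams, B12Sec2to5.Lemma4Printed (F12OfRecord₁₂ F N (theta13OfThm1CCMW F N j γ ε₀ ε₂₉ B₃ B₃' a₀ a₁).toStage12Params lam12 P) (lam12 P).consts)
    (h09T : ∃ γ₉ : ℝ, 0 < γ₉ ∧ ∀ w : WorldP, w.C = (datumOfRecord₁₃SepCoPH F N (Stage13HParams.ofHistoryBlind F N ⟨theta13OfThm1CCMW F N j γ ε₀ ε₂₉ B₃ B₃' a₀ a₁, ZrOfRecord₁₃ F N (theta13OfThm1CCMW F N j γ ε₀ ε₂₉ B₃ B₃' a₀ a₁)⟩) (N24_provisos₁₃SepCoPH_door_theta13OfThm1CCMW_of_gauge9TopStepR_of_betaBoxSignFree_allTorus hγ₀ hγh hε hε' hB hB' ha₀ ha₁ h15 hc h9 hbox hbox' hl hβ')).C →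
      w.γ ≤ γ₉ → ∀ P : B12.RunParams, (leavesP w P).smallCouplings → (leavesP w P).smallFieldInductive)
    (h10 : ∃ lam13 : B12.RunParams → ResidB13 (theta13OfThm1CCMW F N j γ ε₀ ε₂₉ B₃ B₃' a₀ a₁).toStage3Params,
      ∀ P : B12.RunParams, B13LeafOfRecord (theta13OfThm1CCMW F N j γ ε₀ ε₂₉ B₃ B₃' a₀ a₁).toStage3Params (lam13 P))
    (h11 : ∀ βup β₀ : ℝ, ∃ γ₁₁ : ℝ, 0 < γ₁₁ ∧ ∀ w : WorldP, w.C = (datumOfRecord₁₃SepCoPH F N (Stage13HParams.ofHistoryBlind F N ⟨theta13OfThm1CCMW F N j γ ε₀ ε₂₉ B₃ B₃' a₀ a₁, ZrOfRecord₁₃ F N (theta13OfThm1CCMW F N j γ ε₀ ε₂₉ B₃ B₃' a₀ a₁)⟩) (N24_provisos₁₃SepCoPH_door_theta13OfThm1CCMW_of_gauge9TopStepR_of_betaBoxSignFree_allTorus hγ₀ hγh hε hε' hB hB' ha₀ ha₁ h15 hc h9 hbox hbox' hl hβ')).C →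
      w.βup = βup → w.β₀ = β₀ → w.γ ≤ γ₁₁ → ∀ P : B12.RunParams, (leavesP w P).b7 → (leavesP w P).b8 → (leavesP w P).b9 → (leavesP w P).b10 → (leavesP w P).b11 →
      (leavesP w P).smallCouplings → (leavesP w P).smallFieldInductive → (leavesP w P).flowControl →
        ∀ k, k < P.K → SLaw₁₃CoPH F N (Stage13HParams.ofHistoryBlind F N ⟨theta13OfThm1CCMW F N j γ ε₀ ε₂₉ B₃ B₃' a₀ a₁, ZrOfRecord₁₃ F N (theta13OfThm1CCMW F N j γ ε₀ ε₂₉ B₃ B₃' a₀ a₁)⟩) P k → TLaw₁₃CoPH F N (Stage13HParams.ofHistoryBlind F N ⟨theta13OfThm1CCMW F N j γ ε₀ ε₂₉ B₃ B₃' a₀ a₁, ZrOfRecord₁₃ F N (theta13OfThm1CCMW F N j γ ε₀ ε₂₉ B₃ B₃' a₀ a₁)⟩) P k)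
    (h12 : ∃ lamW : ResidW F N, (∀ P : B12.RunParams, B15Leaf (WOfRecord₁₃ F N (theta13OfThm1CCMW F N j γ ε₀ ε₂₉ B₃ B₃' a₀ a₁) lamW P)) ∧
      ∀ P : B12.RunParams, 1 ≤ P.K → lamW.kSel P < P.K)
    (hUV : ∃ γ₁₃ : ℝ, 0 < γ₁₃ ∧ ∃ em ep : ℝ → ℝ, ∀ P : B12.RunParams, (genFlow (betaOfRecord₁₃ F N (theta13OfThm1CCMW F N j γ ε₀ ε₂₉ B₃ B₃' a₀ a₁)) P.g0).InInterval γ₁₃ P.K → ∀ k, k ≤ P.K → SLaw₁₃CoPH F N (Stage13HParams.ofHistoryBlind F N ⟨theta13OfThm1CCMW F N j γ ε₀ ε₂₉ B₃ B₃' a₀ a₁, ZrOfRecord₁₃ F N (theta13OfThm1CCMW F N j γ ε₀ ε₂₉ B₃ B₃' a₀ a₁)⟩) P k →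
      ∀ U : GaugeField (F.P P.K) k (SU N),
        chiβOfRecord₁₃ F N (theta13OfThm1CCMW F N j γ ε₀ ε₂₉ B₃ B₃' a₀ a₁) P.K (gOfRecord₁₃ F N (theta13OfThm1CCMW F N j γ ε₀ ε₂₉ B₃ B₃' a₀ a₁) P) k U *
              Real.exp (-(1 / (gOfRecord₁₃ F N (theta13OfThm1CCMW F N j γ ε₀ ε₂₉ B₃ B₃' a₀ a₁) P k) ^ 2 * wilsonBGOfRecord F N (theta13OfThm1CCMW F N j γ ε₀ ε₂₉ B₃ B₃' a₀ a₁).εbg P k U)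
                - em (gOfRecord₁₃ F N (theta13OfThm1CCMW F N j γ ε₀ ε₂₉ B₃ B₃' a₀ a₁) P k) * (Fintype.card (Site (F.P P.K) k) : ℝ)) ≤ densOfRecord₁₃ F N (theta13OfThm1CCMW F N j γ ε₀ ε₂₉ B₃ B₃' a₀ a₁) P k U ∧
        densOfRecord₁₃ F N (theta13OfThm1CCMW F N j γ ε₀ ε₂₉ B₃ B₃' a₀ a₁) P k U ≤ Real.exp (ep (gOfRecord₁₃ F N (theta13OfThm1CCMW F N j γ ε₀ ε₂₉ B₃ B₃' a₀ a₁) P k) * (Fintype.card (Site (F.P P.K) k) : ℝ)))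
    {B γ₀ : ℝ} (hγR : 0 < γ₀)
    (hceil : ∀ (n : ℕ) (gs : ℕ → ℝ), RGEqH n (betaOfRecord₁₃ F N (theta13OfThm1CCMW F N j γ ε₀ ε₂₉ B₃ B₃' a₀ a₁)) gs → Step.InInterval γ₀ n gs → ∀ k, k ≤ n → betaOfRecord₁₃ F N (theta13OfThm1CCMW F N j γ ε₀ ε₂₉ B₃ B₃' a₀ a₁) k (prefixOf gs k) ≤ B)
    (hnh : ∀ (n : ℕ) (gs : ℕ → ℝ), RGEqH n (betaOfRecord₁₃ F N (theta13OfThm1CCMW F N j γ ε₀ ε₂₉ B₃ B₃' a₀ a₁)) gs → Step.InInterval γ₀ n gs → ∀ m n', m < n' → n' ≤ n → gs m ≤ (1 + 1) * gs n') :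
    ∃ (θ' : Stage13HParams F N) (h' : θ'.Provisos₁₃SepCoPH F N), (θ'.ZhUnity F N ∧ θ'.SlotsNondegenerate₁₃ F N) ∧ θ'.Admissible F N ∧
      B16.EndStatementBPrinted (datumOfRecord₁₃SepCoPH F N θ' h').C ∧
      ∃ γ₁ : ℝ, 0 < γ₁ ∧ ∀ γ : ℝ, 0 < γ → γ ≤ γ₁ → ∃ P : B12.RunParams, 1 ≤ P.K ∧ ((datumOfRecord₁₃SepCoPH F N θ' h').C P).flow.InInterval γ P.K := by
  obtain ⟨lam8, h05⟩ := h05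
  obtain ⟨Mstar, ops, h06⟩ := h06
  obtain ⟨ζ, h07⟩ := h07
  obtain ⟨lam12, h09⟩ := h09
  obtain ⟨lam13, h10⟩ := h10
  obtain ⟨γ₉, hγ₉, h09T⟩ := h09T
  obtain ⟨γ₁₁, hγ₁₁, h11⟩ := h11 B 1
  obtain ⟨lamW, h12, -⟩ := h12
  obtain ⟨γ₁₃, hγ₁₃, em, ep, hUV⟩ := hUV
  have hL1 : (1 : ℝ) < ((theta13OfThm1CCMW F N j γ ε₀ ε₂₉ B₃ B₃' a₀ a₁).L : ℝ) := by exact_mod_cast F.hL.2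
  have hγw0 : 0 < min γ (min γ₉ (min γ₁₁ γ₁₃)) := lt_min hγ₀ (lt_min hγ₉ (lt_min hγ₁₁ hγ₁₃))
  have hγwγ : min γ (min γ₉ (min γ₁₁ γ₁₃)) ≤ γ := min_le_left _ _
  have hγw9 : min γ (min γ₉ (min γ₁₁ γ₁₃)) ≤ γ₉ := (min_le_right _ _).trans (min_le_left _ _)
  have hγw11 : min γ (min γ₉ (min γ₁₁ γ₁₃)) ≤ γ₁₁ := (min_le_right _ _).trans ((min_le_right _ _).trans (min_le_left _ _))
  have hγw13 : min γ (min γ₉ (min γ₁₁ γ₁₃)) ≤ γ₁₃ := (min_le_right _ _).trans ((min_le_right _ _).trans (min_le_right _ _))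
  set γw : ℝ := min γ (min γ₉ (min γ₁₁ γ₁₃))
  let w : WorldP :=
    { C := (datumOfRecord₁₃SepCoPH F N (Stage13HParams.ofHistoryBlind F N ⟨theta13OfThm1CCMW F N j γ ε₀ ε₂₉ B₃ B₃' a₀ a₁, ZrOfRecord₁₃ F N (theta13OfThm1CCMW F N j γ ε₀ ε₂₉ B₃ B₃' a₀ a₁)⟩) (N24_provisos₁₃SepCoPH_door_theta13OfThm1CCMW_of_gauge9TopStepR_of_betaBoxSignFree_allTorus hγ₀ hγh hε hε' hB hB' ha₀ ha₁ h15 hc h9 hbox hbox' hl hβ')).C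
      γ := γw, em := em, ep := ep, βup := B, β₀ := 1, β₀_pos := one_pos, b := 1, b_pos := one_pos
      L := ((theta13OfThm1CCMW F N j γ ε₀ ε₂₉ B₃ B₃' a₀ a₁).L : ℝ), one_lt_L := hL1, gR := 0
      up := upOfRecord₅CS F N (((Stage13HParams.ofHistoryBlind F N ⟨theta13OfThm1CCMW F N j γ ε₀ ε₂₉ B₃ B₃' a₀ a₁, ZrOfRecord₁₃ F N (theta13OfThm1CCMW F N j γ ε₀ ε₂₉ B₃ B₃' a₀ a₁)⟩).rebindX F N (fun P : B12.RunParams => (((((theta13OfThm1CCMW F N j γ ε₀ ε₂₉ B₃ B₃' a₀ a₁).res.X P).withB8OfRecordSubBP (theta13OfThm1CCMW F N j γ ε₀ ε₂₉ B₃ B₃' a₀ a₁).toStage3Params lam8).withB12 (F12OfRecord₁₂ F N (theta13OfThm1CCMW F N j γ ε₀ ε₂₉ B₃ B₃' a₀ a₁).toStage12Params lam12 P) (lam12 P).consts).withB13OfRecord (theta13OfThm1CCMW F N j γ ε₀ ε₂₉ B₃ B₃' a₀ a₁).toStage3Params (lam13 P)))).view₁₃CoPHB10YZW F N Mstar ops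 ζ lamW) }
  have hC : w.C = (datumOfRecord₁₃SepCoPH F N (Stage13HParams.ofHistoryBlind F N ⟨theta13OfThm1CCMW F N j γ ε₀ ε₂₉ B₃ B₃' a₀ a₁, ZrOfRecord₁₃ F N (theta13OfThm1CCMW F N j γ ε₀ ε₂₉ B₃ B₃' a₀ a₁)⟩) (N24_provisos₁₃SepCoPH_door_theta13OfThm1CCMW_of_gauge9TopStepR_of_betaBoxSignFree_allTorus hγ₀ hγh hε hε' hB hB' ha₀ ha₁ h15 hc h9 hbox hbox' hl hβ')).C := rfl
  have hθ := admissible_theta13OfThm1CCMW_of_le_half F N hγ₀ hγh hε hε' hB hB' ha₀ ha₁ (j := j) (ε₀ := ε₀) (ε₂₉ := ε₂₉)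
  have hU : (Stage13HParams.ofHistoryBlind F N ⟨theta13OfThm1CCMW F N j γ ε₀ ε₂₉ B₃ B₃' a₀ a₁, ZrOfRecord₁₃ F N (theta13OfThm1CCMW F N j γ ε₀ ε₂₉ B₃ B₃' a₀ a₁)⟩).ZhUnity F N ∧ (Stage13HParams.ofHistoryBlind F N ⟨theta13OfThm1CCMW F N j γ ε₀ ε₂₉ B₃ B₃' a₀ a₁, ZrOfRecord₁₃ F N (theta13OfThm1CCMW F N j γ ε₀ ε₂₉ B₃ B₃' a₀ a₁)⟩).SlotsNondegenerate₁₃ F N :=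
    ⟨(Stage13RParams.ZrUnity.ofHistoryBlind (θ := ⟨theta13OfThm1CCMW F N j γ ε₀ ε₂₉ B₃ B₃' a₀ a₁, ZrOfRecord₁₃ F N (theta13OfThm1CCMW F N j γ ε₀ ε₂₉ B₃ B₃' a₀ a₁)⟩)
      fun p i ω => finsum_ζ0_ZrOfRecord₁₃ (θ := theta13OfThm1CCMW F N j γ ε₀ ε₂₉ B₃ B₃' a₀ a₁) (p := p) i ω),
     slotsNondegenerate₁₃_theta13OfThm1CCMW F N j γ ε₀ ε₂₉ B₃ B₃' a₀ a₁⟩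
  have hlaws : ∀ (P : B12.RunParams) (k : ℕ), k < P.K → TLaw₁₃CoPH F N (Stage13HParams.ofHistoryBlind F N ⟨theta13OfThm1CCMW F N j γ ε₀ ε₂₉ B₃ B₃' a₀ a₁, ZrOfRecord₁₃ F N (theta13OfThm1CCMW F N j γ ε₀ ε₂₉ B₃ B₃' a₀ a₁)⟩) P k → SLaw₁₃CoPH F N (Stage13HParams.ofHistoryBlind F N ⟨theta13OfThm1CCMW F N j γ ε₀ ε₂₉ B₃ B₃' a₀ a₁, ZrOfRecord₁₃ F N (theta13OfThm1CCMW F N j γ ε₀ ε₂₉ B₃ B₃' a₀ a₁)⟩) P (k + 1) := fun P =>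
    N24_laws₁₃CoPH_theta13OfThm1CCMW (ZrOfRecord₁₃ F N (theta13OfThm1CCMW F N j γ ε₀ ε₂₉ B₃ B₃' a₀ a₁)) (fun p _ _ _ => ZrOfRecord₁₃ F N (theta13OfThm1CCMW F N j γ ε₀ ε₂₉ B₃ B₃' a₀ a₁) p) (fun p _ _ _ => ((theta13OfThm1CCMW F N j γ ε₀ ε₂₉ B₃ B₃' a₀ a₁).Rz p.K).phi) P hγ₀ hγh hε hε' hB hB' ha₀ ha₁
  have hUVw : ∀ P : B12.RunParams, (genFlow (betaOfRecord₁₃ F N (Stage13HParams.ofHistoryBlind F N ⟨theta13OfThm1CCMW F N j γ ε₀ ε₂₉ B₃ B₃' a₀ a₁, ZrOfRecord₁₃ F N (theta13OfThm1CCMW F N j γ ε₀ ε₂₉ B₃ B₃' a₀ a₁)⟩).toStage13Params) P.g0).InInterval w.γ P.K → ∀ k, k ≤ P.K → SLaw₁₃CoPH F N (Stage13HParams.ofHistoryBlind F N ⟨theta13OfThm1CCMW F N j γ ε₀ ε₂₉ B₃ B₃' a₀ a₁, ZrOfRecord₁₃ F N (theta13OfThm1CCMW F N j γ ε₀ ε₂₉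 B₃ B₃' a₀ a₁)⟩) P k →
      ∀ U : GaugeField (F.P P.K) k (SU N),
        chiβOfRecord₁₃ F N (Stage13HParams.ofHistoryBlind F N ⟨theta13OfThm1CCMW F N j γ ε₀ ε₂₉ B₃ B₃' a₀ a₁, ZrOfRecord₁₃ F N (theta13OfThm1CCMW F N j γ ε₀ ε₂₉ B₃ B₃' a₀ a₁)⟩).toStage13Params P.K (gOfRecord₁₃ F N (Stage13HParams.ofHistoryBlind F N ⟨theta13OfThm1CCMW F N j γ ε₀ ε₂₉ B₃ B₃' a₀ a₁, ZrOfRecord₁₃ F N (theta13OfThm1CCMW F N j γ ε₀ ε₂₉ B₃ B₃' a₀ a₁)⟩).toStage13Params P) k U *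
              Real.exp (-(1 / (gOfRecord₁₃ F N (Stage13HParams.ofHistoryBlind F N ⟨theta13OfThm1CCMW F N j γ ε₀ ε₂₉ B₃ B₃' a₀ a₁, ZrOfRecord₁₃ F N (theta13OfThm1CCMW F N j γ ε₀ ε₂₉ B₃ B₃' a₀ a₁)⟩).toStage13Params P k) ^ 2 * wilsonBGOfRecord F N (Stage13HParams.ofHistoryBlind F N ⟨theta13OfThm1CCMW F N j γ ε₀ ε₂₉ B₃ B₃' a₀ a₁, ZrOfRecord₁₃ F N (theta13OfThm1CCMW F N j γ ε₀ ε₂₉ B₃ B₃' a₀ a₁)⟩).εbg P k U)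
                - w.em (gOfRecord₁₃ F N (Stage13HParams.ofHistoryBlind F N ⟨theta13OfThm1CCMW F N j γ ε₀ ε₂₉ B₃ B₃' a₀ a₁, ZrOfRecord₁₃ F N (theta13OfThm1CCMW F N j γ ε₀ ε₂₉ B₃ B₃' a₀ a₁)⟩).toStage13Params P k) * (Fintype.card (Site (F.P P.K) k) : ℝ)) ≤ densOfRecord₁₃ F N (Stage13HParams.ofHistoryBlind F N ⟨theta13OfThm1CCMW F N j γ ε₀ ε₂₉ B₃ B₃' a₀ a₁, ZrOfRecord₁₃ F N (theta13OfThm1CCMW F N j γ ε₀ ε₂₉ B₃ B₃' a₀ a₁)⟩).toStage13Params P k U ∧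
        densOfRecord₁₃ F N (Stage13HParams.ofHistoryBlind F N ⟨theta13OfThm1CCMW F N j γ ε₀ ε₂₉ B₃ B₃' a₀ a₁, ZrOfRecord₁₃ F N (theta13OfThm1CCMW F N j γ ε₀ ε₂₉ B₃ B₃' a₀ a₁)⟩).toStage13Params P k U ≤ Real.exp (w.ep (gOfRecord₁₃ F N (Stage13HParams.ofHistoryBlind F N ⟨theta13OfThm1CCMW F N j γ ε₀ ε₂₉ B₃ B₃' a₀ a₁, ZrOfRecord₁₃ F N (theta13OfThm1CCMW F N j γ ε₀ ε₂₉ B₃ B₃' a₀ a₁)⟩).toStage13Params P k) * (Fintype.card (Site (F.P P.K) k) : ℝ)) :=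
    fun P hI k hk hS U => hUV P (B14Cor3.inInterval_of_le hI hγw13) k hk hS U
  have hR := N24_recordS₁₃SepCoPH_of_upS_rebindX_view (Stage13HParams.ofHistoryBlind F N ⟨theta13OfThm1CCMW F N j γ ε₀ ε₂₉ B₃ B₃' a₀ a₁, ZrOfRecord₁₃ F N (theta13OfThm1CCMW F N j γ ε₀ ε₂₉ B₃ B₃' a₀ a₁)⟩) (N24_provisos₁₃SepCoPH_door_theta13OfThm1CCMW_of_gauge9TopStepR_of_betaBoxSignFree_allTorus hγ₀ hγh hε hε' hB hB' ha₀ ha₁ h15 hc h9 hbox hbox' hl hβ') hθ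
    (fun P : B12.RunParams => (((((theta13OfThm1CCMW F N j γ ε₀ ε₂₉ B₃ B₃' a₀ a₁).res.X P).withB8OfRecordSubBP (theta13OfThm1CCMW F N j γ ε₀ ε₂₉ B₃ B₃' a₀ a₁).toStage3Params lam8).withB12 (F12OfRecord₁₂ F N (theta13OfThm1CCMW F N j γ ε₀ ε₂₉ B₃ B₃' a₀ a₁).toStage12Params lam12 P) (lam12 P).consts).withB13OfRecord (theta13OfThm1CCMW F N j γ ε₀ ε₂₉ B₃ B₃' a₀ a₁).toStage3Params (lam13 P))) Mstar ops ζ lamW w hC ⟨hγw0, hγwγ⟩ rfl (fun P => rfl)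
  have hnodes := N24_nodes₁₃CoPH_rebindXS_fourPin_pointed (Stage13HParams.ofHistoryBlind F N ⟨theta13OfThm1CCMW F N j γ ε₀ ε₂₉ B₃ B₃' a₀ a₁, ZrOfRecord₁₃ F N (theta13OfThm1CCMW F N j γ ε₀ ε₂₉ B₃ B₃' a₀ a₁)⟩) (N24_provisos₁₃SepCoPH_door_theta13OfThm1CCMW_of_gauge9TopStepR_of_betaBoxSignFree_allTorus hγ₀ hγh hε hε' hB hB' ha₀ ha₁ h15 hc h9 hbox hbox' hl hβ').toCore hθ
    (fun P : B12.RunParams => (((((theta13OfThm1CCMW F N j γ ε₀ ε₂₉ B₃ B₃' a₀ a₁).res.X P).withB8OfRecordSubBP (theta13OfThm1CCMW F N j γ ε₀ ε₂₉ B₃ B₃' a₀ a₁).toStage3Params lam8).withB12 (F12OfRecord₁₂ F N (theta13OfThm1CCMW F N j γ ε₀ ε₂₉ B₃ B₃' a₀ a₁).toStage12Params lam12 P) (lam12 P).consts).withB13OfRecord (theta13OfThm1CCMW F N j γ ε₀ ε₂₉ B₃ B₃' a₀ a₁).toStage3Params (lam13 P))) Mstar ops ζ lamW w hC ⟨hγw0,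 hγwγ⟩ rfl (fun P => rfl)
    (fun P => h05) h06 h07 h08 (fun P => h09 P) (h09T w hC hγw9) (fun P _ _ _ _ => h10 P) (h11 w hC rfl rfl hγw11) h12 hlaws hUVw
  obtain ⟨hU', hθ', hEnd, hwin⟩ := stabilityB_body_of_rung1At_of_ceiling_noShrink _ _ w hU hθ hR hnodes hγR hceil hnh
  exact ⟨_, _, hU', hθ', hEnd, hwin⟩

/-- **★★★ NODE O READ AS NO-HALVING ALONE**: K1⁷'s consequent at the witness (general `N`) from the ten world-free children and ONE NODE-O letter — along every (0.20)-run of the witness's β of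
record staying in `]0, γ₀]`, the effective coupling never halves: `g_m ≤ 2·g_{n′}` for `m < n′ ≤ n` ((2.6)'s last member at `β₀ = 1`).  The CEILING is K0's: `BetaUpperH β′ γ β₁₃(θ)` at the door
(§0 `runwiseCeiling_of_betaUpperH` at level `min γ γ₀`), world `(βup, β₀) := (β′, 1)`.  This letter is implied by 32H's partial-sum floor on a shrunk window (P3 n°89 :151∕:186) and not
conversely — the logically weakest NODE-O letter the typed DAG reads.  [cite: Balaban1988Convergent, (2.6) p.255, Cor. 3 (2.50) p.264, Thm 1 p.262; Balaban1987RG1, (0.17)–(0.20) pp.255–256, Thm 2 p.259, Thm 3 p.264, (1.20)–(1.22) p.264, §1 p.264; Balaban1989LargeFieldII, Thm 1 p.355, (0.1) pp.355–356, p.391; Balaban1985Variational, Thm 1 (8)–(9) p.279, Prop. 8 p.304; Balaban1985RegularSpaces, Prop. 6 p.99 (bookkeeping)] -/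
theorem N24_stabilityBR13SepCoPH_worldBuilt_childrenSplit_noHalving_theta13OfThm1CCMW_of_gauge9TopStepR_of_betaBoxSignFree_allTorus_door {j c : ℕ} {γ ε₀ ε₂₉ B₃ B₃' a₀ a₁ : ℝ} (hγ₀ : 0 < γ) (hγh : γ ≤ 1 / 2)
    (hε : 0 < ε₀) (hε' : 0 < ε₂₉) (hB : 0 ≤ B₃) (hB' : 0 ≤ B₃') (ha₀ : 0 < a₀) (ha₁ : 0 < a₁)
    (h15 : VariationalThm1RegSepCoP7M F N B₃ a₀ a₁) (hc : c ≤ F.L ^ j)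
    (h9 : Gauge9RegSepTopStepR F N (fun ν K Ω => suppDomOfRecord F ν K Ω) (F.L ^ j) c B₃ B₃' a₀ a₁)
    {bl β' : ℝ} (hbox : BetaLowerH bl γ (betaOfRecord₁₃ F N (theta13OfThm1CCMW F N j γ ε₀ ε₂₉ B₃ B₃' a₀ a₁)))
    (hbox' : BetaUpperH β' γ (betaOfRecord₁₃ F N (theta13OfThm1CCMW F N j γ ε₀ ε₂₉ B₃ B₃' a₀ a₁))) (hl : -bl * γ ^ 2 ≤ 3) (hβ' : β' * γ ^ 2 ≤ 3 / 4)
    (h05 : ∃ lam8 : ResidB8 (theta13OfThm1CCMW F N j γ ε₀ ε₂₉ B₃ B₃' a₀ a₁).toStage3Params, B8LeafOfRecordSubBP (theta13OfThm1CCMW F N j γ ε₀ ε₂₉ B₃ B₃' a₀ a₁).toStage3Params lam8)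
    (h06 : ∃ (Mstar : ℕ) (ops : OpsY N (theta13OfThm1CCMW F N j γ ε₀ ε₂₉ B₃ B₃' a₀ a₁).toStage3Params Mstar), B9LeafX (Y9OfRecord N (theta13OfThm1CCMW F N j γ ε₀ ε₂₉ B₃ B₃' a₀ a₁).toStage3Params Mstar ops))
    (h07 : ∃ ζ : ResidZ F N, B11Leaf (Z11OfRecord F N ζ))
    (h08 : PrintedUV3V N F.L)
    (h09 : ∃ lam12 : ResidB12 F N (theta13OfThm1CCMW F N j γ ε₀ ε₂₉ B₃ B₃' a₀ a₁).τ9.M,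
      ∀ P : B12.RunParams, B12Sec2to5.Lemma4Printed (F12OfRecord₁₂ F N (theta13OfThm1CCMW F N j γ ε₀ ε₂₉ B₃ B₃' a₀ a₁).toStage12Params lam12 P) (lam12 P).consts)
    (h09T : ∃ γ₉ : ℝ, 0 < γ₉ ∧ ∀ w : WorldP, w.C = (datumOfRecord₁₃SepCoPH F N (Stage13HParams.ofHistoryBlind F N ⟨theta13OfThm1CCMW F N j γ ε₀ ε₂₉ B₃ B₃' a₀ a₁, ZrOfRecord₁₃ F N (theta13OfThm1CCMW F N j γ ε₀ ε₂₉ B₃ B₃' a₀ a₁)⟩) (N24_provisos₁₃SepCoPH_door_theta13OfThm1CCMW_of_gauge9TopStepR_of_betaBoxSignFree_allTorus hγ₀ hγh hε hε' hB hB' ha₀ ha₁ h15 hc h9 hbox hbox' hl hβ')).C →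
      w.γ ≤ γ₉ → ∀ P : B12.RunParams, (leavesP w P).smallCouplings → (leavesP w P).smallFieldInductive)
    (h10 : ∃ lam13 : B12.RunParams → ResidB13 (theta13OfThm1CCMW F N j γ ε₀ ε₂₉ B₃ B₃' a₀ a₁).toStage3Params,
      ∀ P : B12.RunParams, B13LeafOfRecord (theta13OfThm1CCMW F N j γ ε₀ ε₂₉ B₃ B₃' a₀ a₁).toStage3Params (lam13 P))
    (h11 : ∀ βup β₀ : ℝ, ∃ γ₁₁ : ℝ, 0 < γ₁₁ ∧ ∀ w : WorldP, w.C = (datumOfRecord₁₃SepCoPH F N (Stage13HParams.ofHistoryBlind F N ⟨theta13OfThm1CCMW F N j γ ε₀ ε₂₉ B₃ B₃' a₀ a₁, ZrOfRecord₁₃ F N (theta13OfThm1CCMW F N j γ ε₀ ε₂₉ B₃ B₃' a₀ a₁)⟩) (N24_provisos₁₃SepCoPH_door_theta13OfThm1CCMW_of_gauge9TopStepR_of_betaBoxSignFree_allTorus hγ₀ hγh hε hε' hB hB' ha₀ ha₁ h15 hc h9 hbox hbox' hl hβ')).C →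
      w.βup = βup → w.β₀ = β₀ → w.γ ≤ γ₁₁ → ∀ P : B12.RunParams, (leavesP w P).b7 → (leavesP w P).b8 → (leavesP w P).b9 → (leavesP w P).b10 → (leavesP w P).b11 →
      (leavesP w P).smallCouplings → (leavesP w P).smallFieldInductive → (leavesP w P).flowControl →
        ∀ k, k < P.K → SLaw₁₃CoPH F N (Stage13HParams.ofHistoryBlind F N ⟨theta13OfThm1CCMW F N j γ ε₀ ε₂₉ B₃ B₃' a₀ a₁, ZrOfRecord₁₃ F N (theta13OfThm1CCMW F N j γ ε₀ ε₂₉ B₃ B₃' a₀ a₁)⟩) P k → TLaw₁₃CoPH F N (Stage13HParams.ofHistoryBlind F N ⟨theta13OfThm1CCMW F N j γ ε₀ ε₂₉ B₃ B₃' a₀ a₁, ZrOfRecord₁₃ F N (theta13OfThm1CCMW F N j γ ε₀ ε₂₉ B₃ B₃' a₀ a₁)⟩) P k)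
    (h12 : ∃ lamW : ResidW F N, (∀ P : B12.RunParams, B15Leaf (WOfRecord₁₃ F N (theta13OfThm1CCMW F N j γ ε₀ ε₂₉ B₃ B₃' a₀ a₁) lamW P)) ∧
      ∀ P : B12.RunParams, 1 ≤ P.K → lamW.kSel P < P.K)
    (hUV : ∃ γ₁₃ : ℝ, 0 < γ₁₃ ∧ ∃ em ep : ℝ → ℝ, ∀ P : B12.RunParams, (genFlow (betaOfRecord₁₃ F N (theta13OfThm1CCMW F N j γ ε₀ ε₂₉ B₃ B₃' a₀ a₁)) P.g0).InInterval γ₁₃ P.K → ∀ k, k ≤ P.K → SLaw₁₃CoPH F N (Stage13HParams.ofHistoryBlind F N ⟨theta13OfThm1CCMW F N j γ ε₀ ε₂₉ B₃ B₃' a₀ a₁, ZrOfRecord₁₃ F N (theta13OfThm1CCMW F N j γ ε₀ ε₂₉ B₃ B₃' a₀ a₁)⟩) P k →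
      ∀ U : GaugeField (F.P P.K) k (SU N),
        chiβOfRecord₁₃ F N (theta13OfThm1CCMW F N j γ ε₀ ε₂₉ B₃ B₃' a₀ a₁) P.K (gOfRecord₁₃ F N (theta13OfThm1CCMW F N j γ ε₀ ε₂₉ B₃ B₃' a₀ a₁) P) k U *
              Real.exp (-(1 / (gOfRecord₁₃ F N (theta13OfThm1CCMW F N j γ ε₀ ε₂₉ B₃ B₃' a₀ a₁) P k) ^ 2 * wilsonBGOfRecord F N (theta13OfThm1CCMW F N j γ ε₀ ε₂₉ B₃ B₃' a₀ a₁).εbg P k U)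
                - em (gOfRecord₁₃ F N (theta13OfThm1CCMW F N j γ ε₀ ε₂₉ B₃ B₃' a₀ a₁) P k) * (Fintype.card (Site (F.P P.K) k) : ℝ)) ≤ densOfRecord₁₃ F N (theta13OfThm1CCMW F N j γ ε₀ ε₂₉ B₃ B₃' a₀ a₁) P k U ∧
        densOfRecord₁₃ F N (theta13OfThm1CCMW F N j γ ε₀ ε₂₉ B₃ B₃' a₀ a₁) P k U ≤ Real.exp (ep (gOfRecord₁₃ F N (theta13OfThm1CCMW F N j γ ε₀ ε₂₉ B₃ B₃' a₀ a₁) P k) * (Fintype.card (Site (F.P P.K) k) : ℝ)))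
    {γ₀ : ℝ} (hγR : 0 < γ₀)
    (hnh : ∀ (n : ℕ) (gs : ℕ → ℝ), RGEqH n (betaOfRecord₁₃ F N (theta13OfThm1CCMW F N j γ ε₀ ε₂₉ B₃ B₃' a₀ a₁)) gs → Step.InInterval γ₀ n gs → ∀ m n', m < n' → n' ≤ n → gs m ≤ (1 + 1) * gs n') :
    ∃ (θ' : Stage13HParams F N) (h' : θ'.Provisos₁₃SepCoPH F N), (θ'.ZhUnity F N ∧ θ'.SlotsNondegenerate₁₃ F N) ∧ θ'.Admissible F N ∧
      B16.EndStatementBPrinted (datumOfRecord₁₃SepCoPH F N θ' h').C ∧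
      ∃ γ₁ : ℝ, 0 < γ₁ ∧ ∀ γ : ℝ, 0 < γ → γ ≤ γ₁ → ∃ P : B12.RunParams, 1 ≤ P.K ∧ ((datumOfRecord₁₃SepCoPH F N θ' h').C P).flow.InInterval γ P.K :=
  N24_stabilityBR13SepCoPH_worldBuilt_childrenSplit_ceiling_noHalving_theta13OfThm1CCMW_of_gauge9TopStepR_of_betaBoxSignFree_allTorus_door hγ₀ hγh hε hε' hB hB' ha₀ ha₁ h15 hc h9 hbox hbox' hl hβ'
    h05 h06 h07 h08 h09 h09T h10 h11 h12 hUV (lt_min hγ₀ hγR) (runwiseCeiling_of_betaUpperH hbox' (min_le_left γ γ₀))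
    (fun n gs hrg hI m n' hmn hn' => hnh n gs hrg (fun k hk => ⟨(hI k hk).1, (hI k hk).2.trans (min_le_right γ γ₀)⟩) m n' hmn hn')

/-! ## §2–§3. `N = 2` from the two OPEN V19 stub texts (stub 2′ by name) + the children families + NODE O's no-halving family; the route decl BY NAME -/

/-- **★★★ K1⁷'s θ-KEYED CONSEQUENT AT `F` FROM THE TWO OPEN V19 STUB TEXTS, TEN WORLD-FREE CHILDREN FAMILIES AND NODE O's NO-HALVING FAMILY `hnhF`** (for every door member, SOME level `γ₀ > 0` on
which no in-window (0.20)-run of `β₁₃(θ₁₅ᶜᶜᴹᵂ)` halves its coupling).  Stub 2′ by name (k0-s2-w1 `K0Stub2PrimeHolds.prop6MemberB8AtP_holds`); Part 19's opening otherwise verbatim; then §1.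
[cite: Balaban1988Convergent, (2.6) p.255, Cor. 3 (2.50) p.264, Thm 1 p.262; Balaban1987RG1, (0.17)–(0.20) pp.255–256, Thm 2 p.259, Thm 3 p.264, (1.20)–(1.22) p.264, §1 p.264; Balaban1989LargeFieldII, Thm 1 p.355, (0.1) pp.355–356, p.391; Balaban1985Variational, Thm 1 (8)–(9) p.279, Prop. 8 p.304; Balaban1985RegularSpaces, Prop. 6 p.99 (bookkeeping)] -/
theorem N24_stabilityBR13SepCoPH_consequent_of_stub1_stub3A'_of_childrenSplit_of_noHalving
    (h1F : ∃ B₃ a₀ a₁ : ℝ, 2 * (F.L : ℝ) ^ 2 ≤ B₃ ∧ 0 < a₀ ∧ 0 < a₁ ∧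
      Prop8RegSepTopStep F 2 (fun ν K Ω => suppDomOfRecord F ν K Ω) B₃ a₀ a₁)
    (h3A'F : ∀ (j c : ℕ) (B₃ B₃' a₀ a₁ : ℝ), c ≤ F.L ^ j → 2 * (F.L : ℝ) ^ 2 ≤ B₃ → 0 < B₃' → 0 < a₀ → 0 < a₁ →
      VariationalThm1RegSepCoP7M F 2 B₃ a₀ a₁ →
      Gauge9RegSepTopStepR F 2 (fun ν K Ω => suppDomOfRecord F ν K Ω) (F.L ^ j) c B₃ B₃' a₀ a₁ →
      ∃ γ₀ ε₀ ε₂₉ β' : ℝ, 0 < γ₀ ∧ 0 < ε₀ ∧ 0 < ε₂₉ ∧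
        BetaLowerH (-β') γ₀ (betaOfRecord₁₃ F 2 (theta13OfThm1CCM F 2 j ε₀ ε₂₉ B₃ B₃' a₀ a₁)) ∧
        BetaUpperH β' γ₀ (betaOfRecord₁₃ F 2 (theta13OfThm1CCM F 2 j ε₀ ε₂₉ B₃ B₃' a₀ a₁)))
    (h05F : ∀ {j c : ℕ} {γ ε₀ ε₂₉ B₃ B₃' a₀ a₁ : ℝ} (hγ₀ : 0 < γ) (hγh : γ ≤ 1 / 2) (hε : 0 < ε₀) (hε' : 0 < ε₂₉) (hB : 0 ≤ B₃) (hB' : 0 ≤ B₃') (ha₀ : 0 < a₀) (ha₁ : 0 < a₁) (h15 : VariationalThm1RegSepCoP7M F 2 B₃ a₀ a₁) (hc : c ≤ F.L ^ j) (h9 : Gauge9RegSepTopStepR F 2 (fun ν K Ω => suppDomOfRecord F ν K Ω) (F.L ^ j) c B₃ B₃' a₀ a₁) {bl β' : ℝ} (hbox : BetaLowerH bl γ (betaOfRecord₁₃ F 2 (theta13OfThm1CCMW F 2 j γ ε₀ ε₂₉ B₃ B₃' a₀ a₁))) (hbox' : BetaUpperH β' γ (betaOfRecord₁₃ F 2 (theta13OfThm1CCMW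 F 2 j γ ε₀ ε₂₉ B₃ B₃' a₀ a₁))) (hl : -bl * γ ^ 2 ≤ 3) (hβ' : β' * γ ^ 2 ≤ 3 / 4),
      ∃ lam8 : ResidB8 (theta13OfThm1CCMW F 2 j γ ε₀ ε₂₉ B₃ B₃' a₀ a₁).toStage3Params, B8LeafOfRecordSubBP (theta13OfThm1CCMW F 2 j γ ε₀ ε₂₉ B₃ B₃' a₀ a₁).toStage3Params lam8)
    (h06F : ∀ {j c : ℕ} {γ ε₀ ε₂₉ B₃ B₃' a₀ a₁ : ℝ} (hγ₀ : 0 < γ) (hγh : γ ≤ 1 / 2) (hε : 0 < ε₀) (hε' : 0 < ε₂₉) (hB : 0 ≤ B₃) (hB' : 0 ≤ B₃') (ha₀ : 0 < a₀) (ha₁ : 0 < a₁) (h15 : VariationalThm1RegSepCoP7M F 2 B₃ a₀ a₁) (hc : c ≤ F.L ^ j) (h9 : Gauge9RegSepTopStepR F 2 (fun ν K Ω => suppDomOfRecord F ν K Ω) (F.L ^ j) c B₃ B₃' a₀ a₁) {bl β' : ℝ} (hbox : BetaLowerH bl γ (betaOfRecord₁₃ F 2 (theta13OfThm1CCMW F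 2 j γ ε₀ ε₂₉ B₃ B₃' a₀ a₁))) (hbox' : BetaUpperH β' γ (betaOfRecord₁₃ F 2 (theta13OfThm1CCMW F 2 j γ ε₀ ε₂₉ B₃ B₃' a₀ a₁))) (hl : -bl * γ ^ 2 ≤ 3) (hβ' : β' * γ ^ 2 ≤ 3 / 4),
      ∃ (Mstar : ℕ) (ops : OpsY 2 (theta13OfThm1CCMW F 2 j γ ε₀ ε₂₉ B₃ B₃' a₀ a₁).toStage3Params Mstar), B9LeafX (Y9OfRecord 2 (theta13OfThm1CCMW F 2 j γ ε₀ ε₂₉ B₃ B₃' a₀ a₁).toStage3Params Mstar ops))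
    (h07 : ∃ ζ : ResidZ F 2, B11Leaf (Z11OfRecord F 2 ζ))
    (h08 : PrintedUV3V 2 F.L)
    (h09F : ∀ {j c : ℕ} {γ ε₀ ε₂₉ B₃ B₃' a₀ a₁ : ℝ} (hγ₀ : 0 < γ) (hγh : γ ≤ 1 / 2) (hε : 0 < ε₀) (hε' : 0 < ε₂₉) (hB : 0 ≤ B₃) (hB' : 0 ≤ B₃') (ha₀ : 0 < a₀) (ha₁ : 0 < a₁) (h15 : VariationalThm1RegSepCoP7M F 2 B₃ a₀ a₁) (hc : c ≤ F.L ^ j) (h9 : Gauge9RegSepTopStepR F 2 (fun ν K Ω => suppDomOfRecord F ν K Ω) (F.L ^ j) c B₃ B₃' a₀ a₁) {bl β' : ℝ} (hbox : BetaLowerH bl γ (betaOfRecord₁₃ F 2 (theta13OfThm1CCMW F 2 j γ ε₀ ε₂₉ B₃ B₃' a₀ a₁))) (hbox' : BetaUpperH β' γ (betaOfRecord₁₃ F 2 (theta13OfThm1CCMW F 2 j γ ε₀ ε₂₉ B₃ B₃' a₀ a₁))) (hl : -bl * γ ^ 2 ≤ 3) (hβ' : β' * γ ^ 2 ≤ 3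 / 4),
      ∃ lam12 : ResidB12 F 2 (theta13OfThm1CCMW F 2 j γ ε₀ ε₂₉ B₃ B₃' a₀ a₁).τ9.M,
      ∀ P : B12.RunParams, B12Sec2to5.Lemma4Printed (F12OfRecord₁₂ F 2 (theta13OfThm1CCMW F 2 j γ ε₀ ε₂₉ B₃ B₃' a₀ a₁).toStage12Params lam12 P) (lam12 P).consts)
    (h09TF : ∀ {j c : ℕ} {γ ε₀ ε₂₉ B₃ B₃' a₀ a₁ : ℝ} (hγ₀ : 0 < γ) (hγh : γ ≤ 1 / 2) (hε : 0 < ε₀) (hε' : 0 < ε₂₉) (hB : 0 ≤ B₃) (hB' : 0 ≤ B₃') (ha₀ : 0 < a₀) (ha₁ : 0 < a₁) (h15 : VariationalThm1RegSepCoP7M F 2 B₃ a₀ a₁) (hc : c ≤ F.L ^ j) (h9 : Gauge9RegSepTopStepR F 2 (fun ν K Ω => suppDomOfRecord F ν K Ω) (F.L ^ j) c B₃ B₃' a₀ a₁) {bl β' : ℝ} (hbox : BetaLowerH bl γ (betaOfRecord₁₃ F 2 (theta13OfThm1CCMW F 2 j γ ε₀ ε₂₉ B₃ B₃' a₀ a₁)))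 (hbox' : BetaUpperH β' γ (betaOfRecord₁₃ F 2 (theta13OfThm1CCMW F 2 j γ ε₀ ε₂₉ B₃ B₃' a₀ a₁))) (hl : -bl * γ ^ 2 ≤ 3) (hβ' : β' * γ ^ 2 ≤ 3 / 4),
      ∃ γ₉ : ℝ, 0 < γ₉ ∧ ∀ w : WorldP, w.C = (datumOfRecord₁₃SepCoPH F 2 (Stage13HParams.ofHistoryBlind F 2 ⟨theta13OfThm1CCMW F 2 j γ ε₀ ε₂₉ B₃ B₃' a₀ a₁, ZrOfRecord₁₃ F 2 (theta13OfThm1CCMW F 2 j γ ε₀ ε₂₉ B₃ B₃' a₀ a₁)⟩) (N24_provisos₁₃SepCoPH_door_theta13OfThm1CCMW_of_gauge9TopStepR_of_betaBoxSignFree_allTorus hγ₀ hγh hε hε' hB hB' ha₀ ha₁ h15 hc h9 hbox hbox' hl hβ')).C →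
      w.γ ≤ γ₉ → ∀ P : B12.RunParams, (leavesP w P).smallCouplings → (leavesP w P).smallFieldInductive)
    (h10F : ∀ {j c : ℕ} {γ ε₀ ε₂₉ B₃ B₃' a₀ a₁ : ℝ} (hγ₀ : 0 < γ) (hγh : γ ≤ 1 / 2) (hε : 0 < ε₀) (hε' : 0 < ε₂₉) (hB : 0 ≤ B₃) (hB' : 0 ≤ B₃') (ha₀ : 0 < a₀) (ha₁ : 0 < a₁) (h15 : VariationalThm1RegSepCoP7M F 2 B₃ a₀ a₁) (hc : c ≤ F.L ^ j) (h9 : Gauge9RegSepTopStepR F 2 (fun ν K Ω => suppDomOfRecord F ν K Ω) (F.L ^ j) c B₃ B₃' a₀ a₁) {bl β' : ℝ} (hbox : BetaLowerH bl γ (betaOfRecord₁₃ F 2 (theta13OfThm1CCMW F 2 j γ ε₀ ε₂₉ B₃ B₃' a₀ a₁))) (hbox' : BetaUpperH β' γ (betaOfRecord₁₃ F 2 (theta13OfThm1CCMW F 2 j γ ε₀ ε₂₉ B₃ B₃' a₀ a₁))) (hl : -bl * γ ^ 2 ≤ 3) (hβ' : β' * γ ^ 2 ≤ 3 / 4),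
      ∃ lam13 : B12.RunParams → ResidB13 (theta13OfThm1CCMW F 2 j γ ε₀ ε₂₉ B₃ B₃' a₀ a₁).toStage3Params,
      ∀ P : B12.RunParams, B13LeafOfRecord (theta13OfThm1CCMW F 2 j γ ε₀ ε₂₉ B₃ B₃' a₀ a₁).toStage3Params (lam13 P))
    (h11F : ∀ {j c : ℕ} {γ ε₀ ε₂₉ B₃ B₃' a₀ a₁ : ℝ} (hγ₀ : 0 < γ) (hγh : γ ≤ 1 / 2) (hε : 0 < ε₀) (hε' : 0 < ε₂₉) (hB : 0 ≤ B₃) (hB' : 0 ≤ B₃') (ha₀ : 0 < a₀) (ha₁ : 0 < a₁) (h15 : VariationalThm1RegSepCoP7M F 2 B₃ a₀ a₁) (hc : c ≤ F.L ^ j) (h9 : Gauge9RegSepTopStepR F 2 (fun ν K Ω => suppDomOfRecord F ν K Ω) (F.L ^ j) c B₃ B₃' a₀ a₁) {bl β' : ℝ} (hbox : BetaLowerH bl γ (betaOfRecord₁₃ F 2 (theta13OfThm1CCMW F 2 j γ ε₀ ε₂₉ B₃ B₃' a₀ a₁))) (hbox' : BetaUpperH β' γ (betaOfRecord₁₃ F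 2 (theta13OfThm1CCMW F 2 j γ ε₀ ε₂₉ B₃ B₃' a₀ a₁))) (hl : -bl * γ ^ 2 ≤ 3) (hβ' : β' * γ ^ 2 ≤ 3 / 4),
      ∀ βup β₀ : ℝ, ∃ γ₁₁ : ℝ, 0 < γ₁₁ ∧ ∀ w : WorldP, w.C = (datumOfRecord₁₃SepCoPH F 2 (Stage13HParams.ofHistoryBlind F 2 ⟨theta13OfThm1CCMW F 2 j γ ε₀ ε₂₉ B₃ B₃' a₀ a₁, ZrOfRecord₁₃ F 2 (theta13OfThm1CCMW F 2 j γ ε₀ ε₂₉ B₃ B₃' a₀ a₁)⟩) (N24_provisos₁₃SepCoPH_door_theta13OfThm1CCMW_of_gauge9TopStepR_of_betaBoxSignFree_allTorus hγ₀ hγh hε hε' hB hB' ha₀ ha₁ h15 hc h9 hbox hbox' hl hβ')).C →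
      w.βup = βup → w.β₀ = β₀ → w.γ ≤ γ₁₁ → ∀ P : B12.RunParams, (leavesP w P).b7 → (leavesP w P).b8 → (leavesP w P).b9 → (leavesP w P).b10 → (leavesP w P).b11 →
      (leavesP w P).smallCouplings → (leavesP w P).smallFieldInductive → (leavesP w P).flowControl →
        ∀ k, k < P.K → SLaw₁₃CoPH F 2 (Stage13HParams.ofHistoryBlind F 2 ⟨theta13OfThm1CCMW F 2 j γ ε₀ ε₂₉ B₃ B₃' a₀ a₁, ZrOfRecord₁₃ F 2 (theta13OfThm1CCMW F 2 j γ ε₀ ε₂₉ B₃ B₃' a₀ a₁)⟩) P k → TLaw₁₃CoPH F 2 (Stage13HParams.ofHistoryBlind F 2 ⟨theta13OfThm1CCMW F 2 j γ ε₀ ε₂₉ B₃ B₃' a₀ a₁, ZrOfRecord₁₃ F 2 (theta13OfThm1CCMW F 2 j γ ε₀ ε₂₉ B₃ B₃' a₀ a₁)⟩) P k)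
    (h12F : ∀ {j c : ℕ} {γ ε₀ ε₂₉ B₃ B₃' a₀ a₁ : ℝ} (hγ₀ : 0 < γ) (hγh : γ ≤ 1 / 2) (hε : 0 < ε₀) (hε' : 0 < ε₂₉) (hB : 0 ≤ B₃) (hB' : 0 ≤ B₃') (ha₀ : 0 < a₀) (ha₁ : 0 < a₁) (h15 : VariationalThm1RegSepCoP7M F 2 B₃ a₀ a₁) (hc : c ≤ F.L ^ j) (h9 : Gauge9RegSepTopStepR F 2 (fun ν K Ω => suppDomOfRecord F ν K Ω) (F.L ^ j) c B₃ B₃' a₀ a₁) {bl β' : ℝ} (hbox : BetaLowerH bl γ (betaOfRecord₁₃ F 2 (theta13OfThm1CCMW F 2 j γ ε₀ ε₂₉ B₃ B₃' a₀ a₁))) (hbox' : BetaUpperH β' γ (betaOfRecord₁₃ F 2 (theta13OfThm1CCMW F 2 j γ ε₀ ε₂₉ B₃ B₃' a₀ a₁))) (hl : -bl * γ ^ 2 ≤ 3) (hβ' : β' * γ ^ 2 ≤ 3 / 4),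
      ∃ lamW : ResidW F 2, (∀ P : B12.RunParams, B15Leaf (WOfRecord₁₃ F 2 (theta13OfThm1CCMW F 2 j γ ε₀ ε₂₉ B₃ B₃' a₀ a₁) lamW P)) ∧
      ∀ P : B12.RunParams, 1 ≤ P.K → lamW.kSel P < P.K)
    (hUVF : ∀ {j c : ℕ} {γ ε₀ ε₂₉ B₃ B₃' a₀ a₁ : ℝ} (hγ₀ : 0 < γ) (hγh : γ ≤ 1 / 2) (hε : 0 < ε₀) (hε' : 0 < ε₂₉) (hB : 0 ≤ B₃) (hB' : 0 ≤ B₃') (ha₀ : 0 < a₀) (ha₁ : 0 < a₁) (h15 : VariationalThm1RegSepCoP7M F 2 B₃ a₀ a₁) (hc : c ≤ F.L ^ j) (h9 : Gauge9RegSepTopStepR F 2 (fun ν K Ω => suppDomOfRecord F ν K Ω) (F.L ^ j) c B₃ B₃' a₀ a₁) {bl β' : ℝ} (hbox : BetaLowerH bl γ (betaOfRecord₁₃ F 2 (theta13OfThm1CCMW F 2 j γ ε₀ ε₂₉ B₃ B₃' a₀ a₁))) (hbox' : BetaUpperH β' γ (betaOfRecord₁₃ F 2 (theta13OfThm1CCMW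 F 2 j γ ε₀ ε₂₉ B₃ B₃' a₀ a₁))) (hl : -bl * γ ^ 2 ≤ 3) (hβ' : β' * γ ^ 2 ≤ 3 / 4),
      ∃ γ₁₃ : ℝ, 0 < γ₁₃ ∧ ∃ em ep : ℝ → ℝ, ∀ P : B12.RunParams, (genFlow (betaOfRecord₁₃ F 2 (theta13OfThm1CCMW F 2 j γ ε₀ ε₂₉ B₃ B₃' a₀ a₁)) P.g0).InInterval γ₁₃ P.K → ∀ k, k ≤ P.K → SLaw₁₃CoPH F 2 (Stage13HParams.ofHistoryBlind F 2 ⟨theta13OfThm1CCMW F 2 j γ ε₀ ε₂₉ B₃ B₃' a₀ a₁, ZrOfRecord₁₃ F 2 (theta13OfThm1CCMW F 2 j γ ε₀ ε₂₉ B₃ B₃' a₀ a₁)⟩) P k →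
      ∀ U : GaugeField (F.P P.K) k (SU 2),
        chiβOfRecord₁₃ F 2 (theta13OfThm1CCMW F 2 j γ ε₀ ε₂₉ B₃ B₃' a₀ a₁) P.K (gOfRecord₁₃ F 2 (theta13OfThm1CCMW F 2 j γ ε₀ ε₂₉ B₃ B₃' a₀ a₁) P) k U *
              Real.exp (-(1 / (gOfRecord₁₃ F 2 (theta13OfThm1CCMW F 2 j γ ε₀ ε₂₉ B₃ B₃' a₀ a₁) P k) ^ 2 * wilsonBGOfRecord F 2 (theta13OfThm1CCMW F 2 j γ ε₀ ε₂₉ B₃ B₃' a₀ a₁).εbg P k U)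
                - em (gOfRecord₁₃ F 2 (theta13OfThm1CCMW F 2 j γ ε₀ ε₂₉ B₃ B₃' a₀ a₁) P k) * (Fintype.card (Site (F.P P.K) k) : ℝ)) ≤ densOfRecord₁₃ F 2 (theta13OfThm1CCMW F 2 j γ ε₀ ε₂₉ B₃ B₃' a₀ a₁) P k U ∧
        densOfRecord₁₃ F 2 (theta13OfThm1CCMW F 2 j γ ε₀ ε₂₉ B₃ B₃' a₀ a₁) P k U ≤ Real.exp (ep (gOfRecord₁₃ F 2 (theta13OfThm1CCMW F 2 j γ ε₀ ε₂₉ B₃ B₃' a₀ a₁) P k) * (Fintype.card (Site (F.P P.K) k) : ℝ)))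
    (hnhF : ∀ {j c : ℕ} {γ ε₀ ε₂₉ B₃ B₃' a₀ a₁ : ℝ} (hγ₀ : 0 < γ) (hγh : γ ≤ 1 / 2) (hε : 0 < ε₀) (hε' : 0 < ε₂₉) (hB : 0 ≤ B₃) (hB' : 0 ≤ B₃') (ha₀ : 0 < a₀) (ha₁ : 0 < a₁) (h15 : VariationalThm1RegSepCoP7M F 2 B₃ a₀ a₁) (hc : c ≤ F.L ^ j) (h9 : Gauge9RegSepTopStepR F 2 (fun ν K Ω => suppDomOfRecord F ν K Ω) (F.L ^ j) c B₃ B₃' a₀ a₁) {bl β' : ℝ} (hbox : BetaLowerH bl γ (betaOfRecord₁₃ F 2 (theta13OfThm1CCMW F 2 j γ ε₀ ε₂₉ B₃ B₃' a₀ a₁))) (hbox' : BetaUpperH β' γ (betaOfRecord₁₃ F 2 (theta13OfThm1CCMW F 2 j γ ε₀ ε₂₉ B₃ B₃' a₀ a₁))) (hl : -bl * γ ^ 2 ≤ 3) (hβ' : β' * γ ^ 2 ≤ 3 / 4),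
      ∃ γ₀ : ℝ, 0 < γ₀ ∧ ∀ (n : ℕ) (gs : ℕ → ℝ), RGEqH n (betaOfRecord₁₃ F 2 (theta13OfThm1CCMW F 2 j γ ε₀ ε₂₉ B₃ B₃' a₀ a₁)) gs → Step.InInterval γ₀ n gs →
        ∀ m n', m < n' → n' ≤ n → gs m ≤ (1 + 1) * gs n') :
    ∃ (θ' : Stage13HParams F 2) (h' : θ'.Provisos₁₃SepCoPH F 2), (θ'.ZhUnity F 2 ∧ θ'.SlotsNondegenerate₁₃ F 2) ∧ θ'.Admissible F 2 ∧
      B16.EndStatementBPrinted (datumOfRecord₁₃SepCoPH F 2 θ' h').C ∧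
      ∃ γ₁ : ℝ, 0 < γ₁ ∧ ∀ γ : ℝ, 0 < γ → γ ≤ γ₁ → ∃ P : B12.RunParams, 1 ≤ P.K ∧ ((datumOfRecord₁₃SepCoPH F 2 θ' h').C P).flow.InInterval γ P.K := by
  obtain ⟨B₃, a₀, a₁, hB₃, ha₀, ha₁, h8⟩ := h1F
  have hL0 : (0 : ℝ) < (F.L : ℝ) := by exact_mod_cast lt_trans Nat.zero_lt_one F.hL.2
  have hBpos : (0 : ℝ) < B₃ := lt_of_lt_of_le (mul_pos two_pos (pow_pos hL0 2)) hB₃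
  obtain ⟨j, c, B₉, a₁', hc, hB9, ha₁', ha₁'le, h9⟩ := gauge9Supplier_of_prop6MemberP F (Summit.QuantumFields.YangMills.Theorems.K0Stub2PrimeHolds.prop6MemberB8AtP_holds F) B₃ a₀ a₁ hB₃ ha₀ ha₁ h8
  have h15 : VariationalThm1RegSepCoP7M F 2 B₃ a₀ a₁' := variationalThm1RegSepCoP7M_of_prop8TopStep hBpos (h8.of_le le_rfl ha₁'le)
  obtain ⟨γ₀, ε₀, ε₂₉, β', hγ0, hε, hε', hlow, hup⟩ := h3A'F j c B₃ B₉ a₀ a₁' hc hB₃ hB9 ha₀ ha₁' h15 h9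
  obtain ⟨γ, hγpos, hγh, hl, hu, hlow', hup'⟩ := windowLetters_of_absBetaBoxH hγ0 hlow hup
  have hloW := betaLowerH_theta13OfThm1CCMW_of_half (F := F) (N := 2) (j := j) (ε₀ := ε₀) (ε₂₉ := ε₂₉) (B₃ := B₃) (B₃' := B₉) (a₀ := a₀) (a₁ := a₁') hγh hlow'
  have hupW := betaUpperH_theta13OfThm1CCMW_of_half (F := F) (N := 2) (j := j) (ε₀ := ε₀) (ε₂₉ := ε₂₉) (B₃ := B₃) (B₃' := B₉) (a₀ := a₀) (a₁ := a₁') hγh hup'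
  obtain ⟨γR, hγR, hnh⟩ := hnhF hγpos hγh hε hε' hBpos.le hB9.le ha₀ ha₁' h15 hc h9 hloW hupW hl hu
  exact N24_stabilityBR13SepCoPH_worldBuilt_childrenSplit_noHalving_theta13OfThm1CCMW_of_gauge9TopStepR_of_betaBoxSignFree_allTorus_door hγpos hγh hε hε' hBpos.le hB9.le ha₀ ha₁' h15 hc h9 hloW hupW hl hu
    (h05F hγpos hγh hε hε' hBpos.le hB9.le ha₀ ha₁' h15 hc h9 hloW hupW hl hu) (h06F hγpos hγh hε hε' hBpos.le hB9.le ha₀ ha₁' h15 hc h9 hloW hupW hl hu) h07 h08 (h09F hγpos hγh hε hε' hBpos.le hB9.le ha₀ ha₁' h15 hc h9 hloW hupW hl hu) (h09TF hγpos hγh hε hε' hBpos.le hB9.le ha₀ ha₁' h15 hc h9 hloW hupW hl hu) (h10F hγpos hγh hε hε' hBpos.le hB9.le ha₀ ha₁' h15 hc h9 hloW hupW hl hu) (h11F hγpos hγh hε hε' hBpos.le hB9.le ha₀ ha₁' h15 hc h9 hloW hupW hl hu) (h12F hγpos hγh hε hε' hBpos.le hB9.le ha₀ ha₁' h15 hc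 h9 hloW hupW hl hu) (hUVF hγpos hγh hε hε' hBpos.le hB9.le ha₀ ha₁' h15 hc h9 hloW hupW hl hu) hγR hnh

/-- **★★★★ K1⁷ `StabilityBAtRecordR13SepCoPH` BY NAME FROM V19's TWO OPEN STUB TEXTS BY NAME, THE TEN CHILDREN TYPE-FAMILIES AND NODE O READ AS NO-HALVING ONLY** (Part 29's pattern through
`K1V6Defs.stabilityBAtRecordR13SepCoPH_iff`).  CONDITIONAL (hypothesis families displayed; audit `proof.conditional`); not a closure; no count moved. [cite: Balaban1988Convergent, (2.6) p.255, Cor. 3 (2.50) p.264, Thm 1 p.262; Balaban1987RG1, (0.17)–(0.20) pp.255–256, Thm 2 p.259, Thm 3 p.264, (1.20)–(1.22) p.264, §1 p.264; Balaban1989LargeFieldII, Thm 1 p.355, (0.1) pp.355–356, p.391; Balaban1985Variational, Thm 1 (8)–(9) p.279, Prop. 8 p.304; Balaban1985RegularSpaces, Prop. 6 p.99 (bookkeeping)] -/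
theorem N24_stabilityBAtRecordR13SepCoPH_byName_of_openStubs_of_childrenSplit_of_noHalving
    (h1 : ∀ F : T4Family, Prop8StepCoPAt F) (h3A' : ∀ F : T4Family, AbsBetaBoxAtThm1WitnessCCMGenAt F)
    (h05 : ∀ (F : T4Family) {j c : ℕ} {γ ε₀ ε₂₉ B₃ B₃' a₀ a₁ : ℝ} (hγ₀ : 0 < γ) (hγh : γ ≤ 1 / 2) (hε : 0 < ε₀) (hε' : 0 < ε₂₉) (hB : 0 ≤ B₃) (hB' : 0 ≤ B₃') (ha₀ : 0 < a₀) (ha₁ : 0 < a₁) (h15 : VariationalThm1RegSepCoP7M F 2 B₃ a₀ a₁) (hc : c ≤ F.L ^ j) (h9 : Gauge9RegSepTopStepR F 2 (fun ν K Ω => suppDomOfRecord F ν K Ω) (F.L ^ j) c B₃ B₃' a₀ a₁) {bl β' : ℝ} (hbox : BetaLowerH bl γ (betaOfRecord₁₃ F 2 (theta13OfThm1CCMW F 2 j γ ε₀ ε₂₉ B₃ B₃' a₀ a₁))) (hbox' : BetaUpperH β' γ (betaOfRecord₁₃ F 2 (theta13OfThm1CCMW F 2 j γ ε₀ ε₂₉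 B₃ B₃' a₀ a₁))) (hl : -bl * γ ^ 2 ≤ 3) (hβ' : β' * γ ^ 2 ≤ 3 / 4),
      ∃ lam8 : ResidB8 (theta13OfThm1CCMW F 2 j γ ε₀ ε₂₉ B₃ B₃' a₀ a₁).toStage3Params, B8LeafOfRecordSubBP (theta13OfThm1CCMW F 2 j γ ε₀ ε₂₉ B₃ B₃' a₀ a₁).toStage3Params lam8)
    (h06 : ∀ (F : T4Family) {j c : ℕ} {γ ε₀ ε₂₉ B₃ B₃' a₀ a₁ : ℝ} (hγ₀ : 0 < γ) (hγh : γ ≤ 1 / 2) (hε : 0 < ε₀) (hε' : 0 < ε₂₉) (hB : 0 ≤ B₃) (hB' : 0 ≤ B₃') (ha₀ : 0 < a₀) (ha₁ : 0 < a₁) (h15 : VariationalThm1RegSepCoP7M F 2 B₃ a₀ a₁) (hc : c ≤ F.L ^ j) (h9 : Gauge9RegSepTopStepR F 2 (fun ν K Ω => suppDomOfRecord F ν K Ω) (F.L ^ j) c B₃ B₃' a₀ a₁) {bl β' : ℝ} (hbox : BetaLowerH bl γ (betaOfRecord₁₃ F 2 (theta13OfThm1CCMW F 2 j γ ε₀ ε₂₉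 B₃ B₃' a₀ a₁))) (hbox' : BetaUpperH β' γ (betaOfRecord₁₃ F 2 (theta13OfThm1CCMW F 2 j γ ε₀ ε₂₉ B₃ B₃' a₀ a₁))) (hl : -bl * γ ^ 2 ≤ 3) (hβ' : β' * γ ^ 2 ≤ 3 / 4),
      ∃ (Mstar : ℕ) (ops : OpsY 2 (theta13OfThm1CCMW F 2 j γ ε₀ ε₂₉ B₃ B₃' a₀ a₁).toStage3Params Mstar), B9LeafX (Y9OfRecord 2 (theta13OfThm1CCMW F 2 j γ ε₀ ε₂₉ B₃ B₃' a₀ a₁).toStage3Params Mstar ops))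
    (h07 : ∀ F : T4Family, ∃ ζ : ResidZ F 2, B11Leaf (Z11OfRecord F 2 ζ))
    (h08 : ∀ F : T4Family, PrintedUV3V 2 F.L)
    (h09 : ∀ (F : T4Family) {j c : ℕ} {γ ε₀ ε₂₉ B₃ B₃' a₀ a₁ : ℝ} (hγ₀ : 0 < γ) (hγh : γ ≤ 1 / 2) (hε : 0 < ε₀) (hε' : 0 < ε₂₉) (hB : 0 ≤ B₃) (hB' : 0 ≤ B₃') (ha₀ : 0 < a₀) (ha₁ : 0 < a₁) (h15 : VariationalThm1RegSepCoP7M F 2 B₃ a₀ a₁) (hc : c ≤ F.L ^ j) (h9 : Gauge9RegSepTopStepR F 2 (fun ν K Ω => suppDomOfRecord F ν K Ω) (F.L ^ j) c B₃ B₃' a₀ a₁) {bl β' : ℝ} (hbox : BetaLowerH bl γ (betaOfRecord₁₃ F 2 (theta13OfThm1CCMW F 2 j γ ε₀ ε₂₉ B₃ B₃' a₀ a₁))) (hbox' : BetaUpperH β' γ (betaOfRecord₁₃ F 2 (theta13OfThm1CCMW F 2 j γ ε₀ ε₂₉ B₃ B₃' a₀ a₁))) (hl : -bl * γ ^ 2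 ≤ 3) (hβ' : β' * γ ^ 2 ≤ 3 / 4),
      ∃ lam12 : ResidB12 F 2 (theta13OfThm1CCMW F 2 j γ ε₀ ε₂₉ B₃ B₃' a₀ a₁).τ9.M,
      ∀ P : B12.RunParams, B12Sec2to5.Lemma4Printed (F12OfRecord₁₂ F 2 (theta13OfThm1CCMW F 2 j γ ε₀ ε₂₉ B₃ B₃' a₀ a₁).toStage12Params lam12 P) (lam12 P).consts)
    (h09T : ∀ (F : T4Family) {j c : ℕ} {γ ε₀ ε₂₉ B₃ B₃' a₀ a₁ : ℝ} (hγ₀ : 0 < γ) (hγh : γ ≤ 1 / 2) (hε : 0 < ε₀) (hε' : 0 < ε₂₉) (hB : 0 ≤ B₃) (hB' : 0 ≤ B₃') (ha₀ : 0 < a₀) (ha₁ : 0 < a₁) (h15 : VariationalThm1RegSepCoP7M F 2 B₃ a₀ a₁) (hc : c ≤ F.L ^ j) (h9 : Gauge9RegSepTopStepR F 2 (fun ν K Ω => suppDomOfRecord F ν K Ω) (F.L ^ j) c B₃ B₃' a₀ a₁) {bl β' : ℝ} (hbox : BetaLowerH bl γ (betaOfRecord₁₃ F 2 (theta13OfThm1CCMW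 F 2 j γ ε₀ ε₂₉ B₃ B₃' a₀ a₁))) (hbox' : BetaUpperH β' γ (betaOfRecord₁₃ F 2 (theta13OfThm1CCMW F 2 j γ ε₀ ε₂₉ B₃ B₃' a₀ a₁))) (hl : -bl * γ ^ 2 ≤ 3) (hβ' : β' * γ ^ 2 ≤ 3 / 4),
      ∃ γ₉ : ℝ, 0 < γ₉ ∧ ∀ w : WorldP, w.C = (datumOfRecord₁₃SepCoPH F 2 (Stage13HParams.ofHistoryBlind F 2 ⟨theta13OfThm1CCMW F 2 j γ ε₀ ε₂₉ B₃ B₃' a₀ a₁, ZrOfRecord₁₃ F 2 (theta13OfThm1CCMW F 2 j γ ε₀ ε₂₉ B₃ B₃' a₀ a₁)⟩) (N24_provisos₁₃SepCoPH_door_theta13OfThm1CCMW_of_gauge9TopStepR_of_betaBoxSignFree_allTorus hγ₀ hγh hε hε' hB hB' ha₀ ha₁ h15 hc h9 hbox hbox' hl hβ')).C →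
      w.γ ≤ γ₉ → ∀ P : B12.RunParams, (leavesP w P).smallCouplings → (leavesP w P).smallFieldInductive)
    (h10 : ∀ (F : T4Family) {j c : ℕ} {γ ε₀ ε₂₉ B₃ B₃' a₀ a₁ : ℝ} (hγ₀ : 0 < γ) (hγh : γ ≤ 1 / 2) (hε : 0 < ε₀) (hε' : 0 < ε₂₉) (hB : 0 ≤ B₃) (hB' : 0 ≤ B₃') (ha₀ : 0 < a₀) (ha₁ : 0 < a₁) (h15 : VariationalThm1RegSepCoP7M F 2 B₃ a₀ a₁) (hc : c ≤ F.L ^ j) (h9 : Gauge9RegSepTopStepR F 2 (fun ν K Ω => suppDomOfRecord F ν K Ω) (F.L ^ j) c B₃ B₃' a₀ a₁) {bl β' : ℝ} (hbox : BetaLowerH bl γ (betaOfRecord₁₃ F 2 (theta13OfThm1CCMW F 2 j γ ε₀ ε₂₉ B₃ B₃' a₀ a₁))) (hbox' : BetaUpperH β' γ (betaOfRecord₁₃ F 2 (theta13OfThm1CCMW F 2 j γ ε₀ ε₂₉ B₃ B₃' a₀ a₁))) (hl : -bl * γ ^ 2 ≤ 3) (hβ' : β' * γ ^ 2 ≤ 3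 / 4),
      ∃ lam13 : B12.RunParams → ResidB13 (theta13OfThm1CCMW F 2 j γ ε₀ ε₂₉ B₃ B₃' a₀ a₁).toStage3Params,
      ∀ P : B12.RunParams, B13LeafOfRecord (theta13OfThm1CCMW F 2 j γ ε₀ ε₂₉ B₃ B₃' a₀ a₁).toStage3Params (lam13 P))
    (h11 : ∀ (F : T4Family) {j c : ℕ} {γ ε₀ ε₂₉ B₃ B₃' a₀ a₁ : ℝ} (hγ₀ : 0 < γ) (hγh : γ ≤ 1 / 2) (hε : 0 < ε₀) (hε' : 0 < ε₂₉) (hB : 0 ≤ B₃) (hB' : 0 ≤ B₃') (ha₀ : 0 < a₀) (ha₁ : 0 < a₁) (h15 : VariationalThm1RegSepCoP7M F 2 B₃ a₀ a₁) (hc : c ≤ F.L ^ j) (h9 : Gauge9RegSepTopStepR F 2 (fun ν K Ω => suppDomOfRecord F ν K Ω) (F.L ^ j) c B₃ B₃' a₀ a₁) {bl β' : ℝ} (hbox : BetaLowerH bl γ (betaOfRecord₁₃ F 2 (theta13OfThm1CCMW F 2 j γ ε₀ ε₂₉ B₃ B₃' a₀ a₁))) (hbox' : BetaUpperH β' γ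 (betaOfRecord₁₃ F 2 (theta13OfThm1CCMW F 2 j γ ε₀ ε₂₉ B₃ B₃' a₀ a₁))) (hl : -bl * γ ^ 2 ≤ 3) (hβ' : β' * γ ^ 2 ≤ 3 / 4),
      ∀ βup β₀ : ℝ, ∃ γ₁₁ : ℝ, 0 < γ₁₁ ∧ ∀ w : WorldP, w.C = (datumOfRecord₁₃SepCoPH F 2 (Stage13HParams.ofHistoryBlind F 2 ⟨theta13OfThm1CCMW F 2 j γ ε₀ ε₂₉ B₃ B₃' a₀ a₁, ZrOfRecord₁₃ F 2 (theta13OfThm1CCMW F 2 j γ ε₀ ε₂₉ B₃ B₃' a₀ a₁)⟩) (N24_provisos₁₃SepCoPH_door_theta13OfThm1CCMW_of_gauge9TopStepR_of_betaBoxSignFree_allTorus hγ₀ hγh hε hε' hB hB' ha₀ ha₁ h15 hc h9 hbox hbox' hl hβ')).C →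
      w.βup = βup → w.β₀ = β₀ → w.γ ≤ γ₁₁ → ∀ P : B12.RunParams, (leavesP w P).b7 → (leavesP w P).b8 → (leavesP w P).b9 → (leavesP w P).b10 → (leavesP w P).b11 →
      (leavesP w P).smallCouplings → (leavesP w P).smallFieldInductive → (leavesP w P).flowControl →
        ∀ k, k < P.K → SLaw₁₃CoPH F 2 (Stage13HParams.ofHistoryBlind F 2 ⟨theta13OfThm1CCMW F 2 j γ ε₀ ε₂₉ B₃ B₃' a₀ a₁, ZrOfRecord₁₃ F 2 (theta13OfThm1CCMW F 2 j γ ε₀ ε₂₉ B₃ B₃' a₀ a₁)⟩) P k → TLaw₁₃CoPH F 2 (Stage13HParams.ofHistoryBlind F 2 ⟨theta13OfThm1CCMW F 2 j γ ε₀ ε₂₉ B₃ B₃' a₀ a₁, ZrOfRecord₁₃ F 2 (theta13OfThm1CCMW F 2 j γ ε₀ ε₂₉ B₃ B₃' a₀ a₁)⟩) P k)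
    (h12 : ∀ (F : T4Family) {j c : ℕ} {γ ε₀ ε₂₉ B₃ B₃' a₀ a₁ : ℝ} (hγ₀ : 0 < γ) (hγh : γ ≤ 1 / 2) (hε : 0 < ε₀) (hε' : 0 < ε₂₉) (hB : 0 ≤ B₃) (hB' : 0 ≤ B₃') (ha₀ : 0 < a₀) (ha₁ : 0 < a₁) (h15 : VariationalThm1RegSepCoP7M F 2 B₃ a₀ a₁) (hc : c ≤ F.L ^ j) (h9 : Gauge9RegSepTopStepR F 2 (fun ν K Ω => suppDomOfRecord F ν K Ω) (F.L ^ j) c B₃ B₃' a₀ a₁) {bl β' : ℝ} (hbox : BetaLowerH bl γ (betaOfRecord₁₃ F 2 (theta13OfThm1CCMW F 2 j γ ε₀ ε₂₉ B₃ B₃' a₀ a₁))) (hbox' : BetaUpperH β' γ (betaOfRecord₁₃ F 2 (theta13OfThm1CCMW F 2 j γ ε₀ ε₂₉ B₃ B₃' a₀ a₁))) (hl : -bl * γ ^ 2 ≤ 3) (hβ' : β' * γ ^ 2 ≤ 3 / 4),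
      ∃ lamW : ResidW F 2, (∀ P : B12.RunParams, B15Leaf (WOfRecord₁₃ F 2 (theta13OfThm1CCMW F 2 j γ ε₀ ε₂₉ B₃ B₃' a₀ a₁) lamW P)) ∧
      ∀ P : B12.RunParams, 1 ≤ P.K → lamW.kSel P < P.K)
    (hUV : ∀ (F : T4Family) {j c : ℕ} {γ ε₀ ε₂₉ B₃ B₃' a₀ a₁ : ℝ} (hγ₀ : 0 < γ) (hγh : γ ≤ 1 / 2) (hε : 0 < ε₀) (hε' : 0 < ε₂₉) (hB : 0 ≤ B₃) (hB' : 0 ≤ B₃') (ha₀ : 0 < a₀) (ha₁ : 0 < a₁) (h15 : VariationalThm1RegSepCoP7M F 2 B₃ a₀ a₁) (hc : c ≤ F.L ^ j) (h9 : Gauge9RegSepTopStepR F 2 (fun ν K Ω => suppDomOfRecord F ν K Ω) (F.L ^ j) c B₃ B₃' a₀ a₁) {bl β' : ℝ} (hbox : BetaLowerH bl γ (betaOfRecord₁₃ F 2 (theta13OfThm1CCMW F 2 j γ ε₀ ε₂₉ B₃ B₃' a₀ a₁))) (hbox' : BetaUpperH β' γ (betaOfRecord₁₃ F 2 (theta13OfThm1CCMW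 F 2 j γ ε₀ ε₂₉ B₃ B₃' a₀ a₁))) (hl : -bl * γ ^ 2 ≤ 3) (hβ' : β' * γ ^ 2 ≤ 3 / 4),
      ∃ γ₁₃ : ℝ, 0 < γ₁₃ ∧ ∃ em ep : ℝ → ℝ, ∀ P : B12.RunParams, (genFlow (betaOfRecord₁₃ F 2 (theta13OfThm1CCMW F 2 j γ ε₀ ε₂₉ B₃ B₃' a₀ a₁)) P.g0).InInterval γ₁₃ P.K → ∀ k, k ≤ P.K → SLaw₁₃CoPH F 2 (Stage13HParams.ofHistoryBlind F 2 ⟨theta13OfThm1CCMW F 2 j γ ε₀ ε₂₉ B₃ B₃' a₀ a₁, ZrOfRecord₁₃ F 2 (theta13OfThm1CCMW F 2 j γ ε₀ ε₂₉ B₃ B₃' a₀ a₁)⟩) P k →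
      ∀ U : GaugeField (F.P P.K) k (SU 2),
        chiβOfRecord₁₃ F 2 (theta13OfThm1CCMW F 2 j γ ε₀ ε₂₉ B₃ B₃' a₀ a₁) P.K (gOfRecord₁₃ F 2 (theta13OfThm1CCMW F 2 j γ ε₀ ε₂₉ B₃ B₃' a₀ a₁) P) k U *
              Real.exp (-(1 / (gOfRecord₁₃ F 2 (theta13OfThm1CCMW F 2 j γ ε₀ ε₂₉ B₃ B₃' a₀ a₁) P k) ^ 2 * wilsonBGOfRecord F 2 (theta13OfThm1CCMW F 2 j γ ε₀ ε₂₉ B₃ B₃' a₀ a₁).εbg P k U)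
                - em (gOfRecord₁₃ F 2 (theta13OfThm1CCMW F 2 j γ ε₀ ε₂₉ B₃ B₃' a₀ a₁) P k) * (Fintype.card (Site (F.P P.K) k) : ℝ)) ≤ densOfRecord₁₃ F 2 (theta13OfThm1CCMW F 2 j γ ε₀ ε₂₉ B₃ B₃' a₀ a₁) P k U ∧
        densOfRecord₁₃ F 2 (theta13OfThm1CCMW F 2 j γ ε₀ ε₂₉ B₃ B₃' a₀ a₁) P k U ≤ Real.exp (ep (gOfRecord₁₃ F 2 (theta13OfThm1CCMW F 2 j γ ε₀ ε₂₉ B₃ B₃' a₀ a₁) P k) * (Fintype.card (Site (F.P P.K) k) : ℝ)))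
    (hnh : ∀ (F : T4Family) {j c : ℕ} {γ ε₀ ε₂₉ B₃ B₃' a₀ a₁ : ℝ} (hγ₀ : 0 < γ) (hγh : γ ≤ 1 / 2) (hε : 0 < ε₀) (hε' : 0 < ε₂₉) (hB : 0 ≤ B₃) (hB' : 0 ≤ B₃') (ha₀ : 0 < a₀) (ha₁ : 0 < a₁) (h15 : VariationalThm1RegSepCoP7M F 2 B₃ a₀ a₁) (hc : c ≤ F.L ^ j) (h9 : Gauge9RegSepTopStepR F 2 (fun ν K Ω => suppDomOfRecord F ν K Ω) (F.L ^ j) c B₃ B₃' a₀ a₁) {bl β' : ℝ} (hbox : BetaLowerH bl γ (betaOfRecord₁₃ F 2 (theta13OfThm1CCMW F 2 j γ ε₀ ε₂₉ B₃ B₃' a₀ a₁))) (hbox' : BetaUpperH β' γ (betaOfRecord₁₃ F 2 (theta13OfThm1CCMW F 2 j γ ε₀ ε₂₉ B₃ B₃' a₀ a₁))) (hl : -bl * γ ^ 2 ≤ 3) (hβ' : β' * γ ^ 2 ≤ 3 / 4),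
      ∃ γ₀ : ℝ, 0 < γ₀ ∧ ∀ (n : ℕ) (gs : ℕ → ℝ), RGEqH n (betaOfRecord₁₃ F 2 (theta13OfThm1CCMW F 2 j γ ε₀ ε₂₉ B₃ B₃' a₀ a₁)) gs → Step.InInterval γ₀ n gs →
        ∀ m n', m < n' → n' ≤ n → gs m ≤ (1 + 1) * gs n') :
    Summit.QuantumFields.YangMills.Theses.BalabanUVNodes.StabilityBAtRecordR13SepCoPH :=
  stabilityBAtRecordR13SepCoPH_iff.mpr fun F _ =>
    N24_stabilityBR13SepCoPH_consequent_of_stub1_stub3A'_of_childrenSplit_of_noHalving (h1 F) (h3A' F)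
      (h05 F) (h06 F) (h07 F) (h08 F) (h09 F) (h09T F) (h10 F) (h11 F) (h12 F) (hUV F) (hnh F)

end Summit.QuantumFields.YangMills.BalabanUVNodes.N24K1OfChildrenSplitFlow26LettersWorldBuilt

end
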